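import Summits.CriticalPhenomena.PercolationContinuityZ3.Theorems.Transplant.SkelNegBParamsRootFine
import Summits.CriticalPhenomena.PercolationContinuityZ3.Theorems.Transplant.SkelNegBParamsRootValsA
import Summits.CriticalPhenomena.PercolationContinuityZ3.Theorems.Transplant.SkelNegBParamsRootArithPA
import HarnessLib

/-!
# N1 params, chain of record `NegB`, part RootFine-A — the (ζ′) twin of part RootFine: THE (c)-BLOCK OF THE ROOT RESIDUE AT THE (ζ′) VALUES — p3's
# `hLg₁/hLg₂/hLg₃` (the run's last core lands in `20r₀ ± (b0TA₀ − 1)` / `±(b0TA₁ − 1)`) and `hPf₁/hPf₂/hPf₃` (the run prism inside the root world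
# `[−5r₀+1, 25r₀−1] × [±(5r₁−2)]`) in the LITERAL shapes of the (ζ′) residue theorem (`fcellsA`, `b0TA`, `DofA (Aof κ)`, `lam0/lam1 (Aof κ)`, increments
# `c_i·(Aof κ·(…)/n_L)/D_A`) at `g := gT mk gx`, `f := fT mk fx`, `Nr := KS.NrOfA σ yL`, boxes of part RootVals, for ANY run origin `yL` with `|Λ₀(yL)| ≤ 3m`,
# `|Λ₁(yL)| ≤ 2m`, any `qB` with `4qB ≤ n_L`, GIVEN the two (ζ′) floors `2000·Kq·(RA′+2) ≤ n_L` (`hnA`) and `22000·Kq·(RA′+2) ≤ M_L` (`hMA`) — discharged at the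
# values of record `mk := 0`, `fx := fxA`, `gx := gxA c` by `nL_floorsA` / `ML_floorsA` of part Residuals-A.  (stmt-g16 2026-08-22; NEG-SCOPE §B.19 (ζ′).)
builds on p205010 (kernel theorem, internal audit signed; external expert review pending) — nothing in this file uses p205010; NOTHING is claimed about
the node `SamePDropOfSkeletonNeg₁` (OPEN).  Pure instantiation of parts RootArith-A/RootArithP-A.
Lane `prim-bschramm-*`, seat `prim-bschramm-stmt` (gen 16); helper file (`--supports stmt-CriticalPhenomena-4575 --as helper`); ledger HOME/prim-bschramm-stmt/NEG-PARAMS.md.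
[cite: KozmaNitzan2024, §4 p. 28 ((32) at the root), Lemma 11 (p. 22)] [cite: MartineauTassion2017, §4.3 Lemma 4.2]
-/

noncomputable section

open scoped Classical

namespace Summit.CriticalPhenomena.PercolationContinuityZ3.Theorems.Transplant

namespace PlanarSkeletonNeg

namespace NegB

open Literature.Probability.Percolation Literature.Probability.LatticeModels SimpleGraph
open SkelConc (Consts)
open Skelφ (shearUnit shearUnit_pos)
open Skelφ.StepI (DataN)
open TwoAxis.Para (modulus)
open Neg

namespace KS

section AtT

variable (κ : Consts) {V : Type} [DecidableEq V] [Countable V] {G : SimpleGraph V} [G.LocallyFinite] (Φ : PlanarSkeletonNeg G) (t : V)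
  (p : unitInterval) (D : DataN V) (mk : ℕ) (gx fx : Neg.FSlot)

/-- **`hLg₁`** (`σ = 1`): the last core's fine abscissa lies in `[20r₀ − b0T₀ + 1, 20r₀ + b0T₀ − 1]`. [cite: KozmaNitzan2024, §4 Lemma 11 (p. 22)] -/
theorem hLg₁_RA (hN : EqNumL κ Φ t p D (gT mk gx κ Φ t p D) (fT mk fx κ Φ t p D)) (hκ : (hL κ Φ t p D (gT mk gx κ Φ t p D) (fT mk fx κ Φ t p D)).natAbs ≤ 10 * nL κ Φ t p D (gT mk gx κ Φ t p D) (fT mk fx κ Φ t p D))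
    (y : Site 2) (qB : ℕ) (hq : 4 * qB ≤ nL κ Φ t p D (gT mk gx κ Φ t p D) (fT mk fx κ Φ t p D))
    (hnA : 2000 * Neg.Kq κ * (RA' κ Φ t p D mk + 2) ≤ nL κ Φ t p D (gT mk gx κ Φ t p D) (fT mk fx κ Φ t p D)) (hMA : 22000 * Neg.Kq κ * (RA' κ Φ t p D mk + 2) ≤ ML κ Φ t p D (gT mk gx κ Φ t p D))
    (hΛ : |Λ₀of κ Φ t p D (gT mk gx κ Φ t p D) (fT mk fx κ Φ t p D) y| ≤ 3 * modulus (nL κ Φ t p D (gT mk gx κ Φ t p D) (fT mk fx κ Φ t p D)) (hL κ Φ t p D (gT mk gx κ Φ t p D) (fT mk fx κ Φ t p D)) (vL κ Φ t p D (gT mk gx κ Φ t p D) (fT mk fx κ Φ t p D)) (Skelφ.NegPrm.vβOf (nL κ Φ t p D (gT mk gx κ Φ t p D) (fT mk fx κ Φ t p D)) (hL κ Φ t p D (gT mk gx κ Φ t p D) (fT mk fx κ Φ t p D)) (ℓL κ Φ t p D (gT mk gx κ Φ t p D) (fT mk fx κ Φ t p D)) (vL κ Φ t p D (gT mk gx κ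 Φ t p D) (fT mk fx κ Φ t p D)))) {σ : ℤ} (hσ : σ = 1) :
    20 * ((fcellsA κ Φ t p D (gT mk gx κ Φ t p D) (fT mk fx κ Φ t p D)).r 0 : ℤ) - (b0TA κ Φ t p D (gT mk gx κ Φ t p D) (fT mk fx κ Φ t p D) 0 : ℤ) + 1 ≤
      TwoAxis.Para.coarse (20 * ((fcellsA κ Φ t p D (gT mk gx κ Φ t p D) (fT mk fx κ Φ t p D)).K : ℤ) * (((fcellsA κ Φ t p D (gT mk gx κ Φ t p D) (fT mk fx κ Φ t p D)).s 0 : ℕ) : ℤ)) (Skelφ.NegPrm.DofA (Aof κ) (nL κ Φ t p D (gT mk gx κ Φ t p D) (fT mk fx κ Φ t p D)) (hL κ Φ t p D (gT mk gx κ Φ t p D) (fT mk fx κ Φ t p D)) (ℓL κ Φ t p D (gT mk gx κ Φ t p D) (fT mk fx κ Φ t p D)) (vL κ Φ t p D (gT mk gx κ Φ t p D) (fT mk fx κ Φ t p D)) / 2) (Skelφ.NegPrm.DofA (Aof κ) (nL κ Φ t p D (gT mk gx κ Φ t p D) (fT mk fx κ Φ t p D)) (hL κ Φ t p D (gT mk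 gx κ Φ t p D) (fT mk fx κ Φ t p D)) (ℓL κ Φ t p D (gT mk gx κ Φ t p D) (fT mk fx κ Φ t p D)) (vL κ Φ t p D (gT mk gx κ Φ t p D) (fT mk fx κ Φ t p D))) (TwoAxis.Para.lam0 (Aof κ) (vL κ Φ t p D (gT mk gx κ Φ t p D) (fT mk fx κ Φ t p D)) (Skelφ.NegPrm.vβOf (nL κ Φ t p D (gT mk gx κ Φ t p D) (fT mk fx κ Φ t p D)) (hL κ Φ t p D (gT mk gx κ Φ t p D) (fT mk fx κ Φ t p D)) (ℓL κ Φ t p D (gT mk gx κ Φ t p D) (fT mk fx κ Φ t p D)) (vL κ Φ t p D (gT mk gx κ Φ t p D) (fT mk fx κ Φ t p D))) y) +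
        ((20 * ((fcellsA κ Φ t p D (gT mk gx κ Φ t p D) (fT mk fx κ Φ t p D)).K : ℤ) * (((fcellsA κ Φ t p D (gT mk gx κ Φ t p D) (fT mk fx κ Φ t p D)).s 0 : ℕ) : ℤ)) * (Aof κ * (modulus (nL κ Φ t p D (gT mk gx κ Φ t p D) (fT mk fx κ Φ t p D)) (hL κ Φ t p D (gT mk gx κ Φ t p D) (fT mk fx κ Φ t p D)) (vL κ Φ t p D (gT mk gx κ Φ t p D) (fT mk fx κ Φ t p D)) (Skelφ.NegPrm.vβOf (nL κ Φ t p D (gT mk gx κ Φ t p D) (fT mk fx κ Φ t p D)) (hL κ Φ t p D (gT mk gx κ Φ t p D) (fT mk fx κ Φ t p D)) (ℓL κ Φ t p D (gT mk gx κ Φ t p D) (fT mk fx κ Φ t p D)) (vL κ Φ t p D (gT mk gx κ Φ t p D) (fT mk fx κ Φ t p D))) * (min (σ * (laLo κ Φ t p D (gT mk gx κ Φ t p D) (fT mk fx κ Φ t p D) mk qB (NrOfA κ Φ t p D (gT mk gx κ Φ t p D) (fT mk fx κ Φ t p D) σ y))) (σ * (laHi κ Φ t p D (gT mk gx κ Φ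 t p D) (fT mk fx κ Φ t p D) mk qB (NrOfA κ Φ t p D (gT mk gx κ Φ t p D) (fT mk fx κ Φ t p D) σ y)))) -
          max ((vL κ Φ t p D (gT mk gx κ Φ t p D) (fT mk fx κ Φ t p D)) * ((shearUnit (nL κ Φ t p D (gT mk gx κ Φ t p D) (fT mk fx κ Φ t p D)) (hL κ Φ t p D (gT mk gx κ Φ t p D) (fT mk fx κ Φ t p D)) : ℤ) * (min (σ * (-lbHi κ Φ t p D (gT mk gx κ Φ t p D) (fT mk fx κ Φ t p D) mk (NrOfA κ Φ t p D (gT mk gx κ Φ t p D) (fT mk fx κ Φ t p D) σ y))) (σ * lbHi κ Φ t p D (gT mk gx κ Φ t p D) (fT mk fx κ Φ t p D) mk (NrOfA κ Φ t p D (gT mk gx κ Φ t p D) (fT mk fx κ Φ t p D) σ y)) - 1))) ((vL κ Φ t p D (gT mk gx κ Φ t p D) (fT mk fx κ Φ t p D)) * ((shearUnit (nL κ Φ t p D (gT mk gx κ Φ t p D) (fT mk fx κ Φ t p D)) (hL κ Φ t p D (gT mk gx κ Φ t p D) (fT mk fx κ Φ t p D)) : ℤ) * (max (σ * (-lbHi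 κ Φ t p D (gT mk gx κ Φ t p D) (fT mk fx κ Φ t p D) mk (NrOfA κ Φ t p D (gT mk gx κ Φ t p D) (fT mk fx κ Φ t p D) σ y))) (σ * lbHi κ Φ t p D (gT mk gx κ Φ t p D) (fT mk fx κ Φ t p D) mk (NrOfA κ Φ t p D (gT mk gx κ Φ t p D) (fT mk fx κ Φ t p D) σ y))) + (shearUnit (nL κ Φ t p D (gT mk gx κ Φ t p D) (fT mk fx κ Φ t p D)) (hL κ Φ t p D (gT mk gx κ Φ t p D) (fT mk fx κ Φ t p D)) : ℤ) - 1))) / (nL κ Φ t p D (gT mk gx κ Φ t p D) (fT mk fx κ Φ t p D) : ℤ))) / (Skelφ.NegPrm.DofA (Aof κ) (nL κ Φ t p D (gT mk gx κ Φ t p D) (fT mk fx κ Φ t p D)) (hL κ Φ t p D (gT mk gx κ Φ t p D) (fT mk fx κ Φ t p D)) (ℓL κ Φ t p D (gT mk gx κ Φ t p D) (fT mk fx κ Φ t p D)) (vL κ Φ t p D (gT mk gx κ Φ t p D) (fT mk fx κ Φ t p D))) ∧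
      TwoAxis.Para.coarse (20 * ((fcellsA κ Φ t p D (gT mk gx κ Φ t p D) (fT mk fx κ Φ t p D)).K : ℤ) * (((fcellsA κ Φ t p D (gT mk gx κ Φ t p D) (fT mk fx κ Φ t p D)).s 0 : ℕ) : ℤ)) (Skelφ.NegPrm.DofA (Aof κ) (nL κ Φ t p D (gT mk gx κ Φ t p D) (fT mk fx κ Φ t p D)) (hL κ Φ t p D (gT mk gx κ Φ t p D) (fT mk fx κ Φ t p D)) (ℓL κ Φ t p D (gT mk gx κ Φ t p D) (fT mk fx κ Φ t p D)) (vL κ Φ t p D (gT mk gx κ Φ t p D) (fT mk fx κ Φ t p D)) / 2) (Skelφ.NegPrm.DofA (Aof κ) (nL κ Φ t p D (gT mk gx κ Φ t p D) (fT mk fx κ Φ t p D)) (hL κ Φ t p D (gT mk gx κ Φ t p D) (fT mk fx κ Φ t p D)) (ℓL κ Φ t p D (gT mk gx κ Φ t p D) (fT mk fx κ Φ t p D)) (vL κ Φ t p D (gT mk gx κ Φ t p D) (fT mk fx κ Φ t p D))) (TwoAxis.Para.lam0 (Aof κ) (vL κ Φ t p D (gT mk gx κ Φ t p D) (fT mk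 fx κ Φ t p D)) (Skelφ.NegPrm.vβOf (nL κ Φ t p D (gT mk gx κ Φ t p D) (fT mk fx κ Φ t p D)) (hL κ Φ t p D (gT mk gx κ Φ t p D) (fT mk fx κ Φ t p D)) (ℓL κ Φ t p D (gT mk gx κ Φ t p D) (fT mk fx κ Φ t p D)) (vL κ Φ t p D (gT mk gx κ Φ t p D) (fT mk fx κ Φ t p D))) y) +
        ((20 * ((fcellsA κ Φ t p D (gT mk gx κ Φ t p D) (fT mk fx κ Φ t p D)).K : ℤ) * (((fcellsA κ Φ t p D (gT mk gx κ Φ t p D) (fT mk fx κ Φ t p D)).s 0 : ℕ) : ℤ)) * (Aof κ * (modulus (nL κ Φ t p D (gT mk gx κ Φ t p D) (fT mk fx κ Φ t p D)) (hL κ Φ t p D (gT mk gx κ Φ t p D) (fT mk fx κ Φ t p D)) (vL κ Φ t p D (gT mk gx κ Φ t p D) (fT mk fx κ Φ t p D)) (Skelφ.NegPrm.vβOf (nL κ Φ t p D (gT mk gx κ Φ t p D) (fT mk fx κ Φ t p D)) (hL κ Φ t p D (gT mk gx κ Φ t p D) (fT mk fx κ Φ t p D)) (ℓL κ Φ t p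 D (gT mk gx κ Φ t p D) (fT mk fx κ Φ t p D)) (vL κ Φ t p D (gT mk gx κ Φ t p D) (fT mk fx κ Φ t p D))) * (max (σ * (laLo κ Φ t p D (gT mk gx κ Φ t p D) (fT mk fx κ Φ t p D) mk qB (NrOfA κ Φ t p D (gT mk gx κ Φ t p D) (fT mk fx κ Φ t p D) σ y))) (σ * (laHi κ Φ t p D (gT mk gx κ Φ t p D) (fT mk fx κ Φ t p D) mk qB (NrOfA κ Φ t p D (gT mk gx κ Φ t p D) (fT mk fx κ Φ t p D) σ y)))) -
          min ((vL κ Φ t p D (gT mk gx κ Φ t p D) (fT mk fx κ Φ t p D)) * ((shearUnit (nL κ Φ t p D (gT mk gx κ Φ t p D) (fT mk fx κ Φ t p D)) (hL κ Φ t p D (gT mk gx κ Φ t p D) (fT mk fx κ Φ t p D)) : ℤ) * (min (σ * (-lbHi κ Φ t p D (gT mk gx κ Φ t p D) (fT mk fx κ Φ t p D) mk (NrOfA κ Φ t p D (gT mk gx κ Φ t p D) (fT mk fx κ Φ t p D) σ y))) (σ * lbHi κ Φ t p D (gT mk gx κ Φ t p D) (fT mk fx κ Φ t p D) mk (NrOfA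 κ Φ t p D (gT mk gx κ Φ t p D) (fT mk fx κ Φ t p D) σ y)) - 1))) ((vL κ Φ t p D (gT mk gx κ Φ t p D) (fT mk fx κ Φ t p D)) * ((shearUnit (nL κ Φ t p D (gT mk gx κ Φ t p D) (fT mk fx κ Φ t p D)) (hL κ Φ t p D (gT mk gx κ Φ t p D) (fT mk fx κ Φ t p D)) : ℤ) * (max (σ * (-lbHi κ Φ t p D (gT mk gx κ Φ t p D) (fT mk fx κ Φ t p D) mk (NrOfA κ Φ t p D (gT mk gx κ Φ t p D) (fT mk fx κ Φ t p D) σ y))) (σ * lbHi κ Φ t p D (gT mk gx κ Φ t p D) (fT mk fx κ Φ t p D) mk (NrOfA κ Φ t p D (gT mk gx κ Φ t p D) (fT mk fx κ Φ t p D) σ y))) + (shearUnit (nL κ Φ t p D (gT mk gx κ Φ t p D) (fT mk fx κ Φ t p D)) (hL κ Φ t p D (gT mk gx κ Φ t p D) (fT mk fx κ Φ t p D)) : ℤ) - 1))) / (nL κ Φ t p D (gT mk gx κ Φ t p D) (fT mk fx κ Φ t p D) : ℤ))) / (Skelφ.NegPrm.DofA (Aof κ) (nL κ Φ t p D (gT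 mk gx κ Φ t p D) (fT mk fx κ Φ t p D)) (hL κ Φ t p D (gT mk gx κ Φ t p D) (fT mk fx κ Φ t p D)) (ℓL κ Φ t p D (gT mk gx κ Φ t p D) (fT mk fx κ Φ t p D)) (vL κ Φ t p D (gT mk gx κ Φ t p D) (fT mk fx κ Φ t p D))) + 1 ≤ 20 * ((fcellsA κ Φ t p D (gT mk gx κ Φ t p D) (fT mk fx κ Φ t p D)).r 0 : ℤ) + (b0TA κ Φ t p D (gT mk gx κ Φ t p D) (fT mk fx κ Φ t p D) 0 : ℤ) - 1 := by
  obtain ⟨hn1, hℓ1⟩ := one_le_of_eqNumL κ Φ t p D _ _ hN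
  have hm0 := (Skelφ.NegPrm.modulus_vβOf hn1 (hL κ Φ t p D (gT mk gx κ Φ t p D) (fT mk fx κ Φ t p D)) (ℓL κ Φ t p D (gT mk gx κ Φ t p D) (fT mk fx κ Φ t p D)) (vL κ Φ t p D (gT mk gx κ Φ t p D) (fT mk fx κ Φ t p D))).1
  have hm : (nL κ Φ t p D (gT mk gx κ Φ t p D) (fT mk fx κ Φ t p D) : ℤ) * ((ℓL κ Φ t p D (gT mk gx κ Φ t p D) (fT mk fx κ Φ t p D) : ℤ) - 1) < modulus (nL κ Φ t p D (gT mk gx κ Φ t p D) (fT mk fx κ Φ t p D)) (hL κ Φ t p D (gT mk gx κ Φ t p D) (fT mk fx κ Φ t p D)) (vL κ Φ t p D (gT mk gx κ Φ t p D) (fT mk fx κ Φ t p D)) (Skelφ.NegPrm.vβOf (nL κ Φ t p D (gT mk gx κ Φ t p D) (fT mk fx κ Φ t p D)) (hL κ Φ t p D (gT mk gx κ Φ t p D) (fT mk fx κ Φ t p D)) (ℓL κ Φ t p D (gT mk gx κ Φ t p D) (fT mk fx κ Φ t p D)) (vL κ Φ t p D (gT mk gx κ Φ t p D) (fT mk fx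 κ Φ t p D))) := by linarith
  obtain ⟨hc0, hc1, hr0, hr1, hb0, hb1, hu0, hu1⟩ := units_eqA κ Φ t p D (gT mk gx κ Φ t p D) (fT mk fx κ Φ t p D)
  have hA2 : (2 : ℤ) ≤ Aof κ := by have := le_Aof κ; linarith
  have hAe : (2 : ℤ) ∣ Aof κ := ⟨10 * (Neg.K κ : ℤ), by rw [Aof_eq_K]; ring⟩
  have hKq : (1 : ℤ) ≤ (Neg.Kq κ : ℤ) := by exact_mod_cast Neg.one_le_Kq κ
  have hv : |(vL κ Φ t p D (gT mk gx κ Φ t p D) (fT mk fx κ Φ t p D))| ≤ (nL κ Φ t p D (gT mk gx κ Φ t p D) (fT mk fx κ Φ t p D) : ℤ) := hN.v_le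
  have hn : (1 : ℤ) ≤ (nL κ Φ t p D (gT mk gx κ Φ t p D) (fT mk fx κ Φ t p D) : ℤ) := by exact_mod_cast hn1
  have hsu : (nL κ Φ t p D (gT mk gx κ Φ t p D) (fT mk fx κ Φ t p D) : ℤ) ≤ (shearUnit (nL κ Φ t p D (gT mk gx κ Φ t p D) (fT mk fx κ Φ t p D)) (hL κ Φ t p D (gT mk gx κ Φ t p D) (fT mk fx κ Φ t p D)) : ℤ) ∧ (shearUnit (nL κ Φ t p D (gT mk gx κ Φ t p D) (fT mk fx κ Φ t p D)) (hL κ Φ t p D (gT mk gx κ Φ t p D) (fT mk fx κ Φ t p D)) : ℤ) ≤ 11 * (nL κ Φ t p D (gT mk gx κ Φ t p D) (fT mk fx κ Φ t p D) : ℤ) := by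
    have h10 : (((hL κ Φ t p D (gT mk gx κ Φ t p D) (fT mk fx κ Φ t p D))).natAbs : ℤ) ≤ 10 * (nL κ Φ t p D (gT mk gx κ Φ t p D) (fT mk fx κ Φ t p D) : ℤ) := by exact_mod_cast hκ
    have h0 : (0 : ℤ) ≤ (((hL κ Φ t p D (gT mk gx κ Φ t p D) (fT mk fx κ Φ t p D))).natAbs : ℤ) := by positivity
    unfold Skelφ.shearUnit
    simp only [Nat.cast_add]
    constructor <;> linarith
  obtain ⟨hW, hLb⟩ := Wrun_spec κ Φ t p D (gT mk gx κ Φ t p D) (fT mk fx κ Φ t p D) hn1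
  have hW0 : (0 : ℤ) ≤ (Wrun κ Φ t p D (gT mk gx κ Φ t p D) (fT mk fx κ Φ t p D) : ℤ) := by positivity
  have hLb0 : (0 : ℤ) ≤ (Lbrun κ Φ t p D (gT mk gx κ Φ t p D) (fT mk fx κ Φ t p D) : ℤ) := by positivity
  have hRA : (0 : ℤ) ≤ (RA' κ Φ t p D mk : ℤ) := by positivity
  have hRAn : 2000 * (Neg.Kq κ : ℤ) * ((RA' κ Φ t p D mk : ℤ) + 2) ≤ (nL κ Φ t p D (gT mk gx κ Φ t p D) (fT mk fx κ Φ t p D) : ℤ) := by exact_mod_cast hnA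
  have hRAℓ : 22000 * (Neg.Kq κ : ℤ) * ((RA' κ Φ t p D mk : ℤ) + 2) ≤ (ℓL κ Φ t p D (gT mk gx κ Φ t p D) (fT mk fx κ Φ t p D) : ℤ) := by
    have h1 : ((22000 * Neg.Kq κ * (RA' κ Φ t p D mk + 2) : ℕ) : ℤ) ≤ (ML κ Φ t p D (gT mk gx κ Φ t p D) : ℤ) := by exact_mod_cast hMA
    have h2 := hN.ℓ_le
    push_cast at h1; linarith
  have hq0 : (0 : ℤ) ≤ (qB : ℤ) := by positivity
  have hq' : 4 * (qB : ℤ) ≤ (nL κ Φ t p D (gT mk gx κ Φ t p D) (fT mk fx κ Φ t p D) : ℤ) := by exact_mod_cast hq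
  have hN0 : (0 : ℤ) ≤ ((NrOfA κ Φ t p D (gT mk gx κ Φ t p D) (fT mk fx κ Φ t p D) σ y) : ℤ) := by positivity
  obtain ⟨hN', hcen⟩ := NrOfA_spec κ Φ t p D (gT mk gx κ Φ t p D) (fT mk fx κ Φ t p D) hN (σ := σ) (by rw [hσ]; simp) y hΛ
  have hN1 : ((NrOfA κ Φ t p D (gT mk gx κ Φ t p D) (fT mk fx κ Φ t p D) σ y) : ℤ) + 1 ≤ 1000 * (Neg.Kq κ : ℤ) := by
    have : ((0 + 1 + NrOfA κ Φ t p D (gT mk gx κ Φ t p D) (fT mk fx κ Φ t p D) σ y : ℕ) : ℤ) ≤ ((1000 * Neg.Kq κ : ℕ) : ℤ) := by exact_mod_cast hN'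
    push_cast at this; linarith
  subst hσ
  have ec : FcA κ Φ t p D (gT mk gx κ Φ t p D) (fT mk fx κ Φ t p D) y + (1) * u₀A κ Φ t p D (gT mk gx κ Φ t p D) (fT mk fx κ Φ t p D) * (((NrOfA κ Φ t p D (gT mk gx κ Φ t p D) (fT mk fx κ Φ t p D) 1 y) : ℤ) + 1) - (1) * (800 * (Neg.Kq κ : ℤ)) * u₀A κ Φ t p D (gT mk gx κ Φ t p D) (fT mk fx κ Φ t p D) =
      FcA κ Φ t p D (gT mk gx κ Φ t p D) (fT mk fx κ Φ t p D) y + u₀A κ Φ t p D (gT mk gx κ Φ t p D) (fT mk fx κ Φ t p D) * (((NrOfA κ Φ t p D (gT mk gx κ Φ t p D) (fT mk fx κ Φ t p D) 1 y) : ℤ) + 1) - 800 * (Neg.Kq κ : ℤ) * u₀A κ Φ t p D (gT mk gx κ Φ t p D) (fT mk fx κ Φ t p D) := by ring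
  rw [ec, FcA_eq_lit] at hcen
  unfold laLo laHi lbHi TwoAxis.Para.coarse
  rw [hc0, DofA_eq', (lam_eqA κ Φ t p D (gT mk gx κ Φ t p D) (fT mk fx κ Φ t p D) y).1]
  have e1 : 20 * ((fcellsA κ Φ t p D (gT mk gx κ Φ t p D) (fT mk fx κ Φ t p D)).r 0 : ℤ) - (b0TA κ Φ t p D (gT mk gx κ Φ t p D) (fT mk fx κ Φ t p D) 0 : ℤ) + 1 = 800 * (Neg.Kq κ : ℤ) * u₀A κ Φ t p D (gT mk gx κ Φ t p D) (fT mk fx κ Φ t p D) - 10 * (Neg.Kq κ : ℤ) * u₀A κ Φ t p D (gT mk gx κ Φ t p D) (fT mk fx κ Φ t p D) + 1 := by rw [hr0, hb0]; ring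
  have e2 : 20 * ((fcellsA κ Φ t p D (gT mk gx κ Φ t p D) (fT mk fx κ Φ t p D)).r 0 : ℤ) + (b0TA κ Φ t p D (gT mk gx κ Φ t p D) (fT mk fx κ Φ t p D) 0 : ℤ) - 1 = 800 * (Neg.Kq κ : ℤ) * u₀A κ Φ t p D (gT mk gx κ Φ t p D) (fT mk fx κ Φ t p D) + 10 * (Neg.Kq κ : ℤ) * u₀A κ Φ t p D (gT mk gx κ Φ t p D) (fT mk fx κ Φ t p D) - 1 := by rw [hr0, hb0]; ring
  rw [e1, e2]
  exact RootArithA.along_posA (A := Aof κ) (Q := (Neg.Kq κ : ℤ)) (u := u₀A κ Φ t p D (gT mk gx κ Φ t p D) (fT mk fx κ Φ t p D)) (Λ := Λ₀of κ Φ t p D (gT mk gx κ Φ t p D) (fT mk fx κ Φ t p D) y) hA2 hKq hu0 hn hm hsu.1 hsu.2 hv hW hW0 hRA hRAn hRAℓ hq0 hq' hN0 hN1 hcen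

/-- **`hLg₂`** (`σ = −1`). [cite: KozmaNitzan2024, §4 Lemma 11 (p. 22)] -/
theorem hLg₂_RA (hN : EqNumL κ Φ t p D (gT mk gx κ Φ t p D) (fT mk fx κ Φ t p D)) (hκ : (hL κ Φ t p D (gT mk gx κ Φ t p D) (fT mk fx κ Φ t p D)).natAbs ≤ 10 * nL κ Φ t p D (gT mk gx κ Φ t p D) (fT mk fx κ Φ t p D))
    (y : Site 2) (qB : ℕ) (hq : 4 * qB ≤ nL κ Φ t p D (gT mk gx κ Φ t p D) (fT mk fx κ Φ t p D))
    (hnA : 2000 * Neg.Kq κ * (RA' κ Φ t p D mk + 2) ≤ nL κ Φ t p D (gT mk gx κ Φ t p D) (fT mk fx κ Φ t p D)) (hMA : 22000 * Neg.Kq κ * (RA' κ Φ t p D mk + 2) ≤ ML κ Φ t p D (gT mk gx κ Φ t p D))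
    (hΛ : |Λ₀of κ Φ t p D (gT mk gx κ Φ t p D) (fT mk fx κ Φ t p D) y| ≤ 3 * modulus (nL κ Φ t p D (gT mk gx κ Φ t p D) (fT mk fx κ Φ t p D)) (hL κ Φ t p D (gT mk gx κ Φ t p D) (fT mk fx κ Φ t p D)) (vL κ Φ t p D (gT mk gx κ Φ t p D) (fT mk fx κ Φ t p D)) (Skelφ.NegPrm.vβOf (nL κ Φ t p D (gT mk gx κ Φ t p D) (fT mk fx κ Φ t p D)) (hL κ Φ t p D (gT mk gx κ Φ t p D) (fT mk fx κ Φ t p D)) (ℓL κ Φ t p D (gT mk gx κ Φ t p D) (fT mk fx κ Φ t p D)) (vL κ Φ t p D (gT mk gx κ Φ t p D) (fT mk fx κ Φ t p D)))) {σ : ℤ} (hσ : σ = -1) :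
    20 * ((fcellsA κ Φ t p D (gT mk gx κ Φ t p D) (fT mk fx κ Φ t p D)).r 0 : ℤ) - (b0TA κ Φ t p D (gT mk gx κ Φ t p D) (fT mk fx κ Φ t p D) 0 : ℤ) + 1 ≤
      -(TwoAxis.Para.coarse (20 * ((fcellsA κ Φ t p D (gT mk gx κ Φ t p D) (fT mk fx κ Φ t p D)).K : ℤ) * (((fcellsA κ Φ t p D (gT mk gx κ Φ t p D) (fT mk fx κ Φ t p D)).s 0 : ℕ) : ℤ)) (Skelφ.NegPrm.DofA (Aof κ) (nL κ Φ t p D (gT mk gx κ Φ t p D) (fT mk fx κ Φ t p D)) (hL κ Φ t p D (gT mk gx κ Φ t p D) (fT mk fx κ Φ t p D)) (ℓL κ Φ t p D (gT mk gx κ Φ t p D) (fT mk fx κ Φ t p D)) (vL κ Φ t p D (gT mk gx κ Φ t p D) (fT mk fx κ Φ t p D)) / 2) (Skelφ.NegPrm.DofA (Aof κ) (nL κ Φ t p D (gT mk gx κ Φ t p D) (fT mk fx κ Φ t p D)) (hL κ Φ t p D (gT mk gx κ Φ t p D) (fT mk fx κ Φ t p D)) (ℓL κ Φ t p D (gT mk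 gx κ Φ t p D) (fT mk fx κ Φ t p D)) (vL κ Φ t p D (gT mk gx κ Φ t p D) (fT mk fx κ Φ t p D))) (TwoAxis.Para.lam0 (Aof κ) (vL κ Φ t p D (gT mk gx κ Φ t p D) (fT mk fx κ Φ t p D)) (Skelφ.NegPrm.vβOf (nL κ Φ t p D (gT mk gx κ Φ t p D) (fT mk fx κ Φ t p D)) (hL κ Φ t p D (gT mk gx κ Φ t p D) (fT mk fx κ Φ t p D)) (ℓL κ Φ t p D (gT mk gx κ Φ t p D) (fT mk fx κ Φ t p D)) (vL κ Φ t p D (gT mk gx κ Φ t p D) (fT mk fx κ Φ t p D))) y) +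
        ((20 * ((fcellsA κ Φ t p D (gT mk gx κ Φ t p D) (fT mk fx κ Φ t p D)).K : ℤ) * (((fcellsA κ Φ t p D (gT mk gx κ Φ t p D) (fT mk fx κ Φ t p D)).s 0 : ℕ) : ℤ)) * (Aof κ * (modulus (nL κ Φ t p D (gT mk gx κ Φ t p D) (fT mk fx κ Φ t p D)) (hL κ Φ t p D (gT mk gx κ Φ t p D) (fT mk fx κ Φ t p D)) (vL κ Φ t p D (gT mk gx κ Φ t p D) (fT mk fx κ Φ t p D)) (Skelφ.NegPrm.vβOf (nL κ Φ t p D (gT mk gx κ Φ t p D) (fT mk fx κ Φ t p D)) (hL κ Φ t p D (gT mk gx κ Φ t p D) (fT mk fx κ Φ t p D)) (ℓL κ Φ t p D (gT mk gx κ Φ t p D) (fT mk fx κ Φ t p D)) (vL κ Φ t p D (gT mk gx κ Φ t p D) (fT mk fx κ Φ t p D))) * (max (σ * (laLo κ Φ t p D (gT mk gx κ Φ t p D) (fT mk fx κ Φ t p D) mk qB (NrOfA κ Φ t p D (gT mk gx κ Φ t p D) (fT mk fx κ Φ t p D) σ y))) (σ * (laHi κ Φ t p D (gT mk gx κ Φ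 t p D) (fT mk fx κ Φ t p D) mk qB (NrOfA κ Φ t p D (gT mk gx κ Φ t p D) (fT mk fx κ Φ t p D) σ y)))) -
          min ((vL κ Φ t p D (gT mk gx κ Φ t p D) (fT mk fx κ Φ t p D)) * ((shearUnit (nL κ Φ t p D (gT mk gx κ Φ t p D) (fT mk fx κ Φ t p D)) (hL κ Φ t p D (gT mk gx κ Φ t p D) (fT mk fx κ Φ t p D)) : ℤ) * (min (σ * (-lbHi κ Φ t p D (gT mk gx κ Φ t p D) (fT mk fx κ Φ t p D) mk (NrOfA κ Φ t p D (gT mk gx κ Φ t p D) (fT mk fx κ Φ t p D) σ y))) (σ * lbHi κ Φ t p D (gT mk gx κ Φ t p D) (fT mk fx κ Φ t p D) mk (NrOfA κ Φ t p D (gT mk gx κ Φ t p D) (fT mk fx κ Φ t p D) σ y)) - 1))) ((vL κ Φ t p D (gT mk gx κ Φ t p D) (fT mk fx κ Φ t p D)) * ((shearUnit (nL κ Φ t p D (gT mk gx κ Φ t p D) (fT mk fx κ Φ t p D)) (hL κ Φ t p D (gT mk gx κ Φ t p D) (fT mk fx κ Φ t p D)) : ℤ) * (max (σ * (-lbHi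 κ Φ t p D (gT mk gx κ Φ t p D) (fT mk fx κ Φ t p D) mk (NrOfA κ Φ t p D (gT mk gx κ Φ t p D) (fT mk fx κ Φ t p D) σ y))) (σ * lbHi κ Φ t p D (gT mk gx κ Φ t p D) (fT mk fx κ Φ t p D) mk (NrOfA κ Φ t p D (gT mk gx κ Φ t p D) (fT mk fx κ Φ t p D) σ y))) + (shearUnit (nL κ Φ t p D (gT mk gx κ Φ t p D) (fT mk fx κ Φ t p D)) (hL κ Φ t p D (gT mk gx κ Φ t p D) (fT mk fx κ Φ t p D)) : ℤ) - 1))) / (nL κ Φ t p D (gT mk gx κ Φ t p D) (fT mk fx κ Φ t p D) : ℤ))) / (Skelφ.NegPrm.DofA (Aof κ) (nL κ Φ t p D (gT mk gx κ Φ t p D) (fT mk fx κ Φ t p D)) (hL κ Φ t p D (gT mk gx κ Φ t p D) (fT mk fx κ Φ t p D)) (ℓL κ Φ t p D (gT mk gx κ Φ t p D) (fT mk fx κ Φ t p D)) (vL κ Φ t p D (gT mk gx κ Φ t p D) (fT mk fx κ Φ t p D))) + 1) ∧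
      -(TwoAxis.Para.coarse (20 * ((fcellsA κ Φ t p D (gT mk gx κ Φ t p D) (fT mk fx κ Φ t p D)).K : ℤ) * (((fcellsA κ Φ t p D (gT mk gx κ Φ t p D) (fT mk fx κ Φ t p D)).s 0 : ℕ) : ℤ)) (Skelφ.NegPrm.DofA (Aof κ) (nL κ Φ t p D (gT mk gx κ Φ t p D) (fT mk fx κ Φ t p D)) (hL κ Φ t p D (gT mk gx κ Φ t p D) (fT mk fx κ Φ t p D)) (ℓL κ Φ t p D (gT mk gx κ Φ t p D) (fT mk fx κ Φ t p D)) (vL κ Φ t p D (gT mk gx κ Φ t p D) (fT mk fx κ Φ t p D)) / 2) (Skelφ.NegPrm.DofA (Aof κ) (nL κ Φ t p D (gT mk gx κ Φ t p D) (fT mk fx κ Φ t p D)) (hL κ Φ t p D (gT mk gx κ Φ t p D) (fT mk fx κ Φ t p D)) (ℓL κ Φ t p D (gT mk gx κ Φ t p D) (fT mk fx κ Φ t p D)) (vL κ Φ t p D (gT mk gx κ Φ t p D) (fT mk fx κ Φ t p D))) (TwoAxis.Para.lam0 (Aof κ) (vL κ Φ t p D (gT mk gx κ Φ t p D) (fT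 mk fx κ Φ t p D)) (Skelφ.NegPrm.vβOf (nL κ Φ t p D (gT mk gx κ Φ t p D) (fT mk fx κ Φ t p D)) (hL κ Φ t p D (gT mk gx κ Φ t p D) (fT mk fx κ Φ t p D)) (ℓL κ Φ t p D (gT mk gx κ Φ t p D) (fT mk fx κ Φ t p D)) (vL κ Φ t p D (gT mk gx κ Φ t p D) (fT mk fx κ Φ t p D))) y) +
        ((20 * ((fcellsA κ Φ t p D (gT mk gx κ Φ t p D) (fT mk fx κ Φ t p D)).K : ℤ) * (((fcellsA κ Φ t p D (gT mk gx κ Φ t p D) (fT mk fx κ Φ t p D)).s 0 : ℕ) : ℤ)) * (Aof κ * (modulus (nL κ Φ t p D (gT mk gx κ Φ t p D) (fT mk fx κ Φ t p D)) (hL κ Φ t p D (gT mk gx κ Φ t p D) (fT mk fx κ Φ t p D)) (vL κ Φ t p D (gT mk gx κ Φ t p D) (fT mk fx κ Φ t p D)) (Skelφ.NegPrm.vβOf (nL κ Φ t p D (gT mk gx κ Φ t p D) (fT mk fx κ Φ t p D)) (hL κ Φ t p D (gT mk gx κ Φ t p D) (fT mk fx κ Φ t p D)) (ℓL κ Φ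 t p D (gT mk gx κ Φ t p D) (fT mk fx κ Φ t p D)) (vL κ Φ t p D (gT mk gx κ Φ t p D) (fT mk fx κ Φ t p D))) * (min (σ * (laLo κ Φ t p D (gT mk gx κ Φ t p D) (fT mk fx κ Φ t p D) mk qB (NrOfA κ Φ t p D (gT mk gx κ Φ t p D) (fT mk fx κ Φ t p D) σ y))) (σ * (laHi κ Φ t p D (gT mk gx κ Φ t p D) (fT mk fx κ Φ t p D) mk qB (NrOfA κ Φ t p D (gT mk gx κ Φ t p D) (fT mk fx κ Φ t p D) σ y)))) -
          max ((vL κ Φ t p D (gT mk gx κ Φ t p D) (fT mk fx κ Φ t p D)) * ((shearUnit (nL κ Φ t p D (gT mk gx κ Φ t p D) (fT mk fx κ Φ t p D)) (hL κ Φ t p D (gT mk gx κ Φ t p D) (fT mk fx κ Φ t p D)) : ℤ) * (min (σ * (-lbHi κ Φ t p D (gT mk gx κ Φ t p D) (fT mk fx κ Φ t p D) mk (NrOfA κ Φ t p D (gT mk gx κ Φ t p D) (fT mk fx κ Φ t p D) σ y))) (σ * lbHi κ Φ t p D (gT mk gx κ Φ t p D) (fT mk fx κ Φ t p D) mk (NrOfA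 κ Φ t p D (gT mk gx κ Φ t p D) (fT mk fx κ Φ t p D) σ y)) - 1))) ((vL κ Φ t p D (gT mk gx κ Φ t p D) (fT mk fx κ Φ t p D)) * ((shearUnit (nL κ Φ t p D (gT mk gx κ Φ t p D) (fT mk fx κ Φ t p D)) (hL κ Φ t p D (gT mk gx κ Φ t p D) (fT mk fx κ Φ t p D)) : ℤ) * (max (σ * (-lbHi κ Φ t p D (gT mk gx κ Φ t p D) (fT mk fx κ Φ t p D) mk (NrOfA κ Φ t p D (gT mk gx κ Φ t p D) (fT mk fx κ Φ t p D) σ y))) (σ * lbHi κ Φ t p D (gT mk gx κ Φ t p D) (fT mk fx κ Φ t p D) mk (NrOfA κ Φ t p D (gT mk gx κ Φ t p D) (fT mk fx κ Φ t p D) σ y))) + (shearUnit (nL κ Φ t p D (gT mk gx κ Φ t p D) (fT mk fx κ Φ t p D)) (hL κ Φ t p D (gT mk gx κ Φ t p D) (fT mk fx κ Φ t p D)) : ℤ) - 1))) / (nL κ Φ t p D (gT mk gx κ Φ t p D) (fT mk fx κ Φ t p D) : ℤ))) / (Skelφ.NegPrm.DofA (Aof κ) (nL κ Φ t p D (gT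 mk gx κ Φ t p D) (fT mk fx κ Φ t p D)) (hL κ Φ t p D (gT mk gx κ Φ t p D) (fT mk fx κ Φ t p D)) (ℓL κ Φ t p D (gT mk gx κ Φ t p D) (fT mk fx κ Φ t p D)) (vL κ Φ t p D (gT mk gx κ Φ t p D) (fT mk fx κ Φ t p D)))) ≤ 20 * ((fcellsA κ Φ t p D (gT mk gx κ Φ t p D) (fT mk fx κ Φ t p D)).r 0 : ℤ) + (b0TA κ Φ t p D (gT mk gx κ Φ t p D) (fT mk fx κ Φ t p D) 0 : ℤ) - 1 := by
  obtain ⟨hn1, hℓ1⟩ := one_le_of_eqNumL κ Φ t p D _ _ hN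
  have hm0 := (Skelφ.NegPrm.modulus_vβOf hn1 (hL κ Φ t p D (gT mk gx κ Φ t p D) (fT mk fx κ Φ t p D)) (ℓL κ Φ t p D (gT mk gx κ Φ t p D) (fT mk fx κ Φ t p D)) (vL κ Φ t p D (gT mk gx κ Φ t p D) (fT mk fx κ Φ t p D))).1
  have hm : (nL κ Φ t p D (gT mk gx κ Φ t p D) (fT mk fx κ Φ t p D) : ℤ) * ((ℓL κ Φ t p D (gT mk gx κ Φ t p D) (fT mk fx κ Φ t p D) : ℤ) - 1) < modulus (nL κ Φ t p D (gT mk gx κ Φ t p D) (fT mk fx κ Φ t p D)) (hL κ Φ t p D (gT mk gx κ Φ t p D) (fT mk fx κ Φ t p D)) (vL κ Φ t p D (gT mk gx κ Φ t p D) (fT mk fx κ Φ t p D)) (Skelφ.NegPrm.vβOf (nL κ Φ t p D (gT mk gx κ Φ t p D) (fT mk fx κ Φ t p D)) (hL κ Φ t p D (gT mk gx κ Φ t p D) (fT mk fx κ Φ t p D)) (ℓL κ Φ t p D (gT mk gx κ Φ t p D) (fT mk fx κ Φ t p D)) (vL κ Φ t p D (gT mk gx κ Φ t p D) (fT mk fx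 κ Φ t p D))) := by linarith
  obtain ⟨hc0, hc1, hr0, hr1, hb0, hb1, hu0, hu1⟩ := units_eqA κ Φ t p D (gT mk gx κ Φ t p D) (fT mk fx κ Φ t p D)
  have hA2 : (2 : ℤ) ≤ Aof κ := by have := le_Aof κ; linarith
  have hAe : (2 : ℤ) ∣ Aof κ := ⟨10 * (Neg.K κ : ℤ), by rw [Aof_eq_K]; ring⟩
  have hKq : (1 : ℤ) ≤ (Neg.Kq κ : ℤ) := by exact_mod_cast Neg.one_le_Kq κ
  have hv : |(vL κ Φ t p D (gT mk gx κ Φ t p D) (fT mk fx κ Φ t p D))| ≤ (nL κ Φ t p D (gT mk gx κ Φ t p D) (fT mk fx κ Φ t p D) : ℤ) := hN.v_le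
  have hn : (1 : ℤ) ≤ (nL κ Φ t p D (gT mk gx κ Φ t p D) (fT mk fx κ Φ t p D) : ℤ) := by exact_mod_cast hn1
  have hsu : (nL κ Φ t p D (gT mk gx κ Φ t p D) (fT mk fx κ Φ t p D) : ℤ) ≤ (shearUnit (nL κ Φ t p D (gT mk gx κ Φ t p D) (fT mk fx κ Φ t p D)) (hL κ Φ t p D (gT mk gx κ Φ t p D) (fT mk fx κ Φ t p D)) : ℤ) ∧ (shearUnit (nL κ Φ t p D (gT mk gx κ Φ t p D) (fT mk fx κ Φ t p D)) (hL κ Φ t p D (gT mk gx κ Φ t p D) (fT mk fx κ Φ t p D)) : ℤ) ≤ 11 * (nL κ Φ t p D (gT mk gx κ Φ t p D) (fT mk fx κ Φ t p D) : ℤ) := by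
    have h10 : (((hL κ Φ t p D (gT mk gx κ Φ t p D) (fT mk fx κ Φ t p D))).natAbs : ℤ) ≤ 10 * (nL κ Φ t p D (gT mk gx κ Φ t p D) (fT mk fx κ Φ t p D) : ℤ) := by exact_mod_cast hκ
    have h0 : (0 : ℤ) ≤ (((hL κ Φ t p D (gT mk gx κ Φ t p D) (fT mk fx κ Φ t p D))).natAbs : ℤ) := by positivity
    unfold Skelφ.shearUnit
    simp only [Nat.cast_add]
    constructor <;> linarith
  obtain ⟨hW, hLb⟩ := Wrun_spec κ Φ t p D (gT mk gx κ Φ t p D) (fT mk fx κ Φ t p D) hn1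
  have hW0 : (0 : ℤ) ≤ (Wrun κ Φ t p D (gT mk gx κ Φ t p D) (fT mk fx κ Φ t p D) : ℤ) := by positivity
  have hLb0 : (0 : ℤ) ≤ (Lbrun κ Φ t p D (gT mk gx κ Φ t p D) (fT mk fx κ Φ t p D) : ℤ) := by positivity
  have hRA : (0 : ℤ) ≤ (RA' κ Φ t p D mk : ℤ) := by positivity
  have hRAn : 2000 * (Neg.Kq κ : ℤ) * ((RA' κ Φ t p D mk : ℤ) + 2) ≤ (nL κ Φ t p D (gT mk gx κ Φ t p D) (fT mk fx κ Φ t p D) : ℤ) := by exact_mod_cast hnA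
  have hRAℓ : 22000 * (Neg.Kq κ : ℤ) * ((RA' κ Φ t p D mk : ℤ) + 2) ≤ (ℓL κ Φ t p D (gT mk gx κ Φ t p D) (fT mk fx κ Φ t p D) : ℤ) := by
    have h1 : ((22000 * Neg.Kq κ * (RA' κ Φ t p D mk + 2) : ℕ) : ℤ) ≤ (ML κ Φ t p D (gT mk gx κ Φ t p D) : ℤ) := by exact_mod_cast hMA
    have h2 := hN.ℓ_le
    push_cast at h1; linarith
  have hq0 : (0 : ℤ) ≤ (qB : ℤ) := by positivity
  have hq' : 4 * (qB : ℤ) ≤ (nL κ Φ t p D (gT mk gx κ Φ t p D) (fT mk fx κ Φ t p D) : ℤ) := by exact_mod_cast hq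
  have hN0 : (0 : ℤ) ≤ ((NrOfA κ Φ t p D (gT mk gx κ Φ t p D) (fT mk fx κ Φ t p D) σ y) : ℤ) := by positivity
  obtain ⟨hN', hcen⟩ := NrOfA_spec κ Φ t p D (gT mk gx κ Φ t p D) (fT mk fx κ Φ t p D) hN (σ := σ) (by rw [hσ]; simp) y hΛ
  have hN1 : ((NrOfA κ Φ t p D (gT mk gx κ Φ t p D) (fT mk fx κ Φ t p D) σ y) : ℤ) + 1 ≤ 1000 * (Neg.Kq κ : ℤ) := by
    have : ((0 + 1 + NrOfA κ Φ t p D (gT mk gx κ Φ t p D) (fT mk fx κ Φ t p D) σ y : ℕ) : ℤ) ≤ ((1000 * Neg.Kq κ : ℕ) : ℤ) := by exact_mod_cast hN'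
    push_cast at this; linarith
  subst hσ
  have ec : FcA κ Φ t p D (gT mk gx κ Φ t p D) (fT mk fx κ Φ t p D) y + (-1) * u₀A κ Φ t p D (gT mk gx κ Φ t p D) (fT mk fx κ Φ t p D) * (((NrOfA κ Φ t p D (gT mk gx κ Φ t p D) (fT mk fx κ Φ t p D) (-1) y) : ℤ) + 1) - (-1) * (800 * (Neg.Kq κ : ℤ)) * u₀A κ Φ t p D (gT mk gx κ Φ t p D) (fT mk fx κ Φ t p D) =
      FcA κ Φ t p D (gT mk gx κ Φ t p D) (fT mk fx κ Φ t p D) y - u₀A κ Φ t p D (gT mk gx κ Φ t p D) (fT mk fx κ Φ t p D) * (((NrOfA κ Φ t p D (gT mk gx κ Φ t p D) (fT mk fx κ Φ t p D) (-1) y) : ℤ) + 1) + 800 * (Neg.Kq κ : ℤ) * u₀A κ Φ t p D (gT mk gx κ Φ t p D) (fT mk fx κ Φ t p D) := by ring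
  rw [ec, FcA_eq_lit] at hcen
  unfold laLo laHi lbHi TwoAxis.Para.coarse
  rw [hc0, DofA_eq', (lam_eqA κ Φ t p D (gT mk gx κ Φ t p D) (fT mk fx κ Φ t p D) y).1]
  have e1 : 20 * ((fcellsA κ Φ t p D (gT mk gx κ Φ t p D) (fT mk fx κ Φ t p D)).r 0 : ℤ) - (b0TA κ Φ t p D (gT mk gx κ Φ t p D) (fT mk fx κ Φ t p D) 0 : ℤ) + 1 = 800 * (Neg.Kq κ : ℤ) * u₀A κ Φ t p D (gT mk gx κ Φ t p D) (fT mk fx κ Φ t p D) - 10 * (Neg.Kq κ : ℤ) * u₀A κ Φ t p D (gT mk gx κ Φ t p D) (fT mk fx κ Φ t p D) + 1 := by rw [hr0, hb0]; ring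
  have e2 : 20 * ((fcellsA κ Φ t p D (gT mk gx κ Φ t p D) (fT mk fx κ Φ t p D)).r 0 : ℤ) + (b0TA κ Φ t p D (gT mk gx κ Φ t p D) (fT mk fx κ Φ t p D) 0 : ℤ) - 1 = 800 * (Neg.Kq κ : ℤ) * u₀A κ Φ t p D (gT mk gx κ Φ t p D) (fT mk fx κ Φ t p D) + 10 * (Neg.Kq κ : ℤ) * u₀A κ Φ t p D (gT mk gx κ Φ t p D) (fT mk fx κ Φ t p D) - 1 := by rw [hr0, hb0]; ring
  rw [e1, e2]
  exact RootArithA.along_negA (A := Aof κ) (Q := (Neg.Kq κ : ℤ)) (u := u₀A κ Φ t p D (gT mk gx κ Φ t p D) (fT mk fx κ Φ t p D)) (Λ := Λ₀of κ Φ t p D (gT mk gx κ Φ t p D) (fT mk fx κ Φ t p D) y) hA2 hKq hu0 hn hm hsu.1 hsu.2 hv hW hW0 hRA hRAn hRAℓ hq0 hq' hN0 hN1 hcen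

/-- **`hPf₁`** (`σ = 1`): the run prism's fine abscissa inside `[−5r₀ + 1, 25r₀ − 1]`. [cite: KozmaNitzan2024, §4 p. 28] -/
theorem hPf₁_RA (hN : EqNumL κ Φ t p D (gT mk gx κ Φ t p D) (fT mk fx κ Φ t p D)) (hκ : (hL κ Φ t p D (gT mk gx κ Φ t p D) (fT mk fx κ Φ t p D)).natAbs ≤ 10 * nL κ Φ t p D (gT mk gx κ Φ t p D) (fT mk fx κ Φ t p D))
    (y : Site 2) (qB : ℕ) (hq : 4 * qB ≤ nL κ Φ t p D (gT mk gx κ Φ t p D) (fT mk fx κ Φ t p D))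
    (hnA : 2000 * Neg.Kq κ * (RA' κ Φ t p D mk + 2) ≤ nL κ Φ t p D (gT mk gx κ Φ t p D) (fT mk fx κ Φ t p D)) (hMA : 22000 * Neg.Kq κ * (RA' κ Φ t p D mk + 2) ≤ ML κ Φ t p D (gT mk gx κ Φ t p D))
    (hΛ : |Λ₀of κ Φ t p D (gT mk gx κ Φ t p D) (fT mk fx κ Φ t p D) y| ≤ 3 * modulus (nL κ Φ t p D (gT mk gx κ Φ t p D) (fT mk fx κ Φ t p D)) (hL κ Φ t p D (gT mk gx κ Φ t p D) (fT mk fx κ Φ t p D)) (vL κ Φ t p D (gT mk gx κ Φ t p D) (fT mk fx κ Φ t p D)) (Skelφ.NegPrm.vβOf (nL κ Φ t p D (gT mk gx κ Φ t p D) (fT mk fx κ Φ t p D)) (hL κ Φ t p D (gT mk gx κ Φ t p D) (fT mk fx κ Φ t p D)) (ℓL κ Φ t p D (gT mk gx κ Φ t p D) (fT mk fx κ Φ t p D)) (vL κ Φ t p D (gT mk gx κ Φ t p D) (fT mk fx κ Φ t p D)))) {σ : ℤ} (hσ : σ = 1) :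
    -(5 * ((fcellsA κ Φ t p D (gT mk gx κ Φ t p D) (fT mk fx κ Φ t p D)).r 0 : ℤ)) + 1 ≤
      TwoAxis.Para.coarse (20 * ((fcellsA κ Φ t p D (gT mk gx κ Φ t p D) (fT mk fx κ Φ t p D)).K : ℤ) * (((fcellsA κ Φ t p D (gT mk gx κ Φ t p D) (fT mk fx κ Φ t p D)).s 0 : ℕ) : ℤ)) (Skelφ.NegPrm.DofA (Aof κ) (nL κ Φ t p D (gT mk gx κ Φ t p D) (fT mk fx κ Φ t p D)) (hL κ Φ t p D (gT mk gx κ Φ t p D) (fT mk fx κ Φ t p D)) (ℓL κ Φ t p D (gT mk gx κ Φ t p D) (fT mk fx κ Φ t p D)) (vL κ Φ t p D (gT mk gx κ Φ t p D) (fT mk fx κ Φ t p D)) / 2) (Skelφ.NegPrm.DofA (Aof κ) (nL κ Φ t p D (gT mk gx κ Φ t p D) (fT mk fx κ Φ t p D)) (hL κ Φ t p D (gT mk gx κ Φ t p D) (fT mk fx κ Φ t p D)) (ℓL κ Φ t p D (gT mk gx κ Φ t p D) (fT mk fx κ Φ t p D)) (vL κ Φ t p D (gT mk gx κ Φ t p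 D) (fT mk fx κ Φ t p D))) (TwoAxis.Para.lam0 (Aof κ) (vL κ Φ t p D (gT mk gx κ Φ t p D) (fT mk fx κ Φ t p D)) (Skelφ.NegPrm.vβOf (nL κ Φ t p D (gT mk gx κ Φ t p D) (fT mk fx κ Φ t p D)) (hL κ Φ t p D (gT mk gx κ Φ t p D) (fT mk fx κ Φ t p D)) (ℓL κ Φ t p D (gT mk gx κ Φ t p D) (fT mk fx κ Φ t p D)) (vL κ Φ t p D (gT mk gx κ Φ t p D) (fT mk fx κ Φ t p D))) y) +
        ((20 * ((fcellsA κ Φ t p D (gT mk gx κ Φ t p D) (fT mk fx κ Φ t p D)).K : ℤ) * (((fcellsA κ Φ t p D (gT mk gx κ Φ t p D) (fT mk fx κ Φ t p D)).s 0 : ℕ) : ℤ)) * (Aof κ * (modulus (nL κ Φ t p D (gT mk gx κ Φ t p D) (fT mk fx κ Φ t p D)) (hL κ Φ t p D (gT mk gx κ Φ t p D) (fT mk fx κ Φ t p D)) (vL κ Φ t p D (gT mk gx κ Φ t p D) (fT mk fx κ Φ t p D)) (Skelφ.NegPrm.vβOf (nL κ Φ t p D (gT mk gx κ Φ t p D)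 (fT mk fx κ Φ t p D)) (hL κ Φ t p D (gT mk gx κ Φ t p D) (fT mk fx κ Φ t p D)) (ℓL κ Φ t p D (gT mk gx κ Φ t p D) (fT mk fx κ Φ t p D)) (vL κ Φ t p D (gT mk gx κ Φ t p D) (fT mk fx κ Φ t p D))) * (min (σ * (paLo κ Φ t p D (gT mk gx κ Φ t p D) (fT mk fx κ Φ t p D) mk qB (NrOfA κ Φ t p D (gT mk gx κ Φ t p D) (fT mk fx κ Φ t p D) σ y))) (σ * (paHi κ Φ t p D (gT mk gx κ Φ t p D) (fT mk fx κ Φ t p D) mk qB (NrOfA κ Φ t p D (gT mk gx κ Φ t p D) (fT mk fx κ Φ t p D) σ y)))) -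
          max ((vL κ Φ t p D (gT mk gx κ Φ t p D) (fT mk fx κ Φ t p D)) * ((shearUnit (nL κ Φ t p D (gT mk gx κ Φ t p D) (fT mk fx κ Φ t p D)) (hL κ Φ t p D (gT mk gx κ Φ t p D) (fT mk fx κ Φ t p D)) : ℤ) * (min (σ * (-pbHi κ Φ t p D (gT mk gx κ Φ t p D) (fT mk fx κ Φ t p D) mk (NrOfA κ Φ t p D (gT mk gx κ Φ t p D) (fT mk fx κ Φ t p D) σ y))) (σ * pbHi κ Φ t p D (gT mk gx κ Φ t p D) (fT mk fx κ Φ t p D) mk (NrOfA κ Φ t p D (gT mk gx κ Φ t p D) (fT mk fx κ Φ t p D) σ y)) - 1))) ((vL κ Φ t p D (gT mk gx κ Φ t p D) (fT mk fx κ Φ t p D)) * ((shearUnit (nL κ Φ t p D (gT mk gx κ Φ t p D) (fT mk fx κ Φ t p D)) (hL κ Φ t p D (gT mk gx κ Φ t p D) (fT mk fx κ Φ t p D)) : ℤ) * (max (σ * (-pbHi κ Φ t p D (gT mk gx κ Φ t p D) (fT mk fx κ Φ t p D) mk (NrOfA κ Φ t p D (gT mk gx κ Φ t p D) (fT mk fx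 κ Φ t p D) σ y))) (σ * pbHi κ Φ t p D (gT mk gx κ Φ t p D) (fT mk fx κ Φ t p D) mk (NrOfA κ Φ t p D (gT mk gx κ Φ t p D) (fT mk fx κ Φ t p D) σ y))) + (shearUnit (nL κ Φ t p D (gT mk gx κ Φ t p D) (fT mk fx κ Φ t p D)) (hL κ Φ t p D (gT mk gx κ Φ t p D) (fT mk fx κ Φ t p D)) : ℤ) - 1))) / (nL κ Φ t p D (gT mk gx κ Φ t p D) (fT mk fx κ Φ t p D) : ℤ))) / (Skelφ.NegPrm.DofA (Aof κ) (nL κ Φ t p D (gT mk gx κ Φ t p D) (fT mk fx κ Φ t p D)) (hL κ Φ t p D (gT mk gx κ Φ t p D) (fT mk fx κ Φ t p D)) (ℓL κ Φ t p D (gT mk gx κ Φ t p D) (fT mk fx κ Φ t p D)) (vL κ Φ t p D (gT mk gx κ Φ t p D) (fT mk fx κ Φ t p D))) ∧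
      TwoAxis.Para.coarse (20 * ((fcellsA κ Φ t p D (gT mk gx κ Φ t p D) (fT mk fx κ Φ t p D)).K : ℤ) * (((fcellsA κ Φ t p D (gT mk gx κ Φ t p D) (fT mk fx κ Φ t p D)).s 0 : ℕ) : ℤ)) (Skelφ.NegPrm.DofA (Aof κ) (nL κ Φ t p D (gT mk gx κ Φ t p D) (fT mk fx κ Φ t p D)) (hL κ Φ t p D (gT mk gx κ Φ t p D) (fT mk fx κ Φ t p D)) (ℓL κ Φ t p D (gT mk gx κ Φ t p D) (fT mk fx κ Φ t p D)) (vL κ Φ t p D (gT mk gx κ Φ t p D) (fT mk fx κ Φ t p D)) / 2) (Skelφ.NegPrm.DofA (Aof κ) (nL κ Φ t p D (gT mk gx κ Φ t p D) (fT mk fx κ Φ t p D)) (hL κ Φ t p D (gT mk gx κ Φ t p D) (fT mk fx κ Φ t p D)) (ℓL κ Φ t p D (gT mk gx κ Φ t p D) (fT mk fx κ Φ t p D)) (vL κ Φ t p D (gT mk gx κ Φ t p D) (fT mk fx κ Φ t p D))) (TwoAxis.Para.lam0 (Aof κ) (vL κ Φ t p D (gT mk gx κ Φ t p D) (fT mk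 fx κ Φ t p D)) (Skelφ.NegPrm.vβOf (nL κ Φ t p D (gT mk gx κ Φ t p D) (fT mk fx κ Φ t p D)) (hL κ Φ t p D (gT mk gx κ Φ t p D) (fT mk fx κ Φ t p D)) (ℓL κ Φ t p D (gT mk gx κ Φ t p D) (fT mk fx κ Φ t p D)) (vL κ Φ t p D (gT mk gx κ Φ t p D) (fT mk fx κ Φ t p D))) y) +
        ((20 * ((fcellsA κ Φ t p D (gT mk gx κ Φ t p D) (fT mk fx κ Φ t p D)).K : ℤ) * (((fcellsA κ Φ t p D (gT mk gx κ Φ t p D) (fT mk fx κ Φ t p D)).s 0 : ℕ) : ℤ)) * (Aof κ * (modulus (nL κ Φ t p D (gT mk gx κ Φ t p D) (fT mk fx κ Φ t p D)) (hL κ Φ t p D (gT mk gx κ Φ t p D) (fT mk fx κ Φ t p D)) (vL κ Φ t p D (gT mk gx κ Φ t p D) (fT mk fx κ Φ t p D)) (Skelφ.NegPrm.vβOf (nL κ Φ t p D (gT mk gx κ Φ t p D) (fT mk fx κ Φ t p D)) (hL κ Φ t p D (gT mk gx κ Φ t p D) (fT mk fx κ Φ t p D)) (ℓL κ Φ t p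 D (gT mk gx κ Φ t p D) (fT mk fx κ Φ t p D)) (vL κ Φ t p D (gT mk gx κ Φ t p D) (fT mk fx κ Φ t p D))) * (max (σ * (paLo κ Φ t p D (gT mk gx κ Φ t p D) (fT mk fx κ Φ t p D) mk qB (NrOfA κ Φ t p D (gT mk gx κ Φ t p D) (fT mk fx κ Φ t p D) σ y))) (σ * (paHi κ Φ t p D (gT mk gx κ Φ t p D) (fT mk fx κ Φ t p D) mk qB (NrOfA κ Φ t p D (gT mk gx κ Φ t p D) (fT mk fx κ Φ t p D) σ y)))) -
          min ((vL κ Φ t p D (gT mk gx κ Φ t p D) (fT mk fx κ Φ t p D)) * ((shearUnit (nL κ Φ t p D (gT mk gx κ Φ t p D) (fT mk fx κ Φ t p D)) (hL κ Φ t p D (gT mk gx κ Φ t p D) (fT mk fx κ Φ t p D)) : ℤ) * (min (σ * (-pbHi κ Φ t p D (gT mk gx κ Φ t p D) (fT mk fx κ Φ t p D) mk (NrOfA κ Φ t p D (gT mk gx κ Φ t p D) (fT mk fx κ Φ t p D) σ y))) (σ * pbHi κ Φ t p D (gT mk gx κ Φ t p D) (fT mk fx κ Φ t p D) mk (NrOfA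 κ Φ t p D (gT mk gx κ Φ t p D) (fT mk fx κ Φ t p D) σ y)) - 1))) ((vL κ Φ t p D (gT mk gx κ Φ t p D) (fT mk fx κ Φ t p D)) * ((shearUnit (nL κ Φ t p D (gT mk gx κ Φ t p D) (fT mk fx κ Φ t p D)) (hL κ Φ t p D (gT mk gx κ Φ t p D) (fT mk fx κ Φ t p D)) : ℤ) * (max (σ * (-pbHi κ Φ t p D (gT mk gx κ Φ t p D) (fT mk fx κ Φ t p D) mk (NrOfA κ Φ t p D (gT mk gx κ Φ t p D) (fT mk fx κ Φ t p D) σ y))) (σ * pbHi κ Φ t p D (gT mk gx κ Φ t p D) (fT mk fx κ Φ t p D) mk (NrOfA κ Φ t p D (gT mk gx κ Φ t p D) (fT mk fx κ Φ t p D) σ y))) + (shearUnit (nL κ Φ t p D (gT mk gx κ Φ t p D) (fT mk fx κ Φ t p D)) (hL κ Φ t p D (gT mk gx κ Φ t p D) (fT mk fx κ Φ t p D)) : ℤ) - 1))) / (nL κ Φ t p D (gT mk gx κ Φ t p D) (fT mk fx κ Φ t p D) : ℤ))) / (Skelφ.NegPrm.DofA (Aof κ) (nL κ Φ t p D (gT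 mk gx κ Φ t p D) (fT mk fx κ Φ t p D)) (hL κ Φ t p D (gT mk gx κ Φ t p D) (fT mk fx κ Φ t p D)) (ℓL κ Φ t p D (gT mk gx κ Φ t p D) (fT mk fx κ Φ t p D)) (vL κ Φ t p D (gT mk gx κ Φ t p D) (fT mk fx κ Φ t p D))) + 1 ≤ 25 * ((fcellsA κ Φ t p D (gT mk gx κ Φ t p D) (fT mk fx κ Φ t p D)).r 0 : ℤ) - 1 := by
  obtain ⟨hn1, hℓ1⟩ := one_le_of_eqNumL κ Φ t p D _ _ hN
  have hm0 := (Skelφ.NegPrm.modulus_vβOf hn1 (hL κ Φ t p D (gT mk gx κ Φ t p D) (fT mk fx κ Φ t p D)) (ℓL κ Φ t p D (gT mk gx κ Φ t p D) (fT mk fx κ Φ t p D)) (vL κ Φ t p D (gT mk gx κ Φ t p D) (fT mk fx κ Φ t p D))).1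
  have hm : (nL κ Φ t p D (gT mk gx κ Φ t p D) (fT mk fx κ Φ t p D) : ℤ) * ((ℓL κ Φ t p D (gT mk gx κ Φ t p D) (fT mk fx κ Φ t p D) : ℤ) - 1) < modulus (nL κ Φ t p D (gT mk gx κ Φ t p D) (fT mk fx κ Φ t p D)) (hL κ Φ t p D (gT mk gx κ Φ t p D) (fT mk fx κ Φ t p D)) (vL κ Φ t p D (gT mk gx κ Φ t p D) (fT mk fx κ Φ t p D)) (Skelφ.NegPrm.vβOf (nL κ Φ t p D (gT mk gx κ Φ t p D) (fT mk fx κ Φ t p D)) (hL κ Φ t p D (gT mk gx κ Φ t p D) (fT mk fx κ Φ t p D)) (ℓL κ Φ t p D (gT mk gx κ Φ t p D) (fT mk fx κ Φ t p D)) (vL κ Φ t p D (gT mk gx κ Φ t p D) (fT mk fx κ Φ t p D))) := by linarith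
  obtain ⟨hc0, hc1, hr0, hr1, hb0, hb1, hu0, hu1⟩ := units_eqA κ Φ t p D (gT mk gx κ Φ t p D) (fT mk fx κ Φ t p D)
  have hA2 : (2 : ℤ) ≤ Aof κ := by have := le_Aof κ; linarith
  have hAe : (2 : ℤ) ∣ Aof κ := ⟨10 * (Neg.K κ : ℤ), by rw [Aof_eq_K]; ring⟩
  have hKq : (1 : ℤ) ≤ (Neg.Kq κ : ℤ) := by exact_mod_cast Neg.one_le_Kq κ
  have hv : |(vL κ Φ t p D (gT mk gx κ Φ t p D) (fT mk fx κ Φ t p D))| ≤ (nL κ Φ t p D (gT mk gx κ Φ t p D) (fT mk fx κ Φ t p D) : ℤ) := hN.v_le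
  have hn : (1 : ℤ) ≤ (nL κ Φ t p D (gT mk gx κ Φ t p D) (fT mk fx κ Φ t p D) : ℤ) := by exact_mod_cast hn1
  have hsu : (nL κ Φ t p D (gT mk gx κ Φ t p D) (fT mk fx κ Φ t p D) : ℤ) ≤ (shearUnit (nL κ Φ t p D (gT mk gx κ Φ t p D) (fT mk fx κ Φ t p D)) (hL κ Φ t p D (gT mk gx κ Φ t p D) (fT mk fx κ Φ t p D)) : ℤ) ∧ (shearUnit (nL κ Φ t p D (gT mk gx κ Φ t p D) (fT mk fx κ Φ t p D)) (hL κ Φ t p D (gT mk gx κ Φ t p D) (fT mk fx κ Φ t p D)) : ℤ) ≤ 11 * (nL κ Φ t p D (gT mk gx κ Φ t p D) (fT mk fx κ Φ t p D) : ℤ) := by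
    have h10 : (((hL κ Φ t p D (gT mk gx κ Φ t p D) (fT mk fx κ Φ t p D))).natAbs : ℤ) ≤ 10 * (nL κ Φ t p D (gT mk gx κ Φ t p D) (fT mk fx κ Φ t p D) : ℤ) := by exact_mod_cast hκ
    have h0 : (0 : ℤ) ≤ (((hL κ Φ t p D (gT mk gx κ Φ t p D) (fT mk fx κ Φ t p D))).natAbs : ℤ) := by positivity
    unfold Skelφ.shearUnit
    simp only [Nat.cast_add]
    constructor <;> linarith
  obtain ⟨hW, hLb⟩ := Wrun_spec κ Φ t p D (gT mk gx κ Φ t p D) (fT mk fx κ Φ t p D) hn1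
  have hW0 : (0 : ℤ) ≤ (Wrun κ Φ t p D (gT mk gx κ Φ t p D) (fT mk fx κ Φ t p D) : ℤ) := by positivity
  have hLb0 : (0 : ℤ) ≤ (Lbrun κ Φ t p D (gT mk gx κ Φ t p D) (fT mk fx κ Φ t p D) : ℤ) := by positivity
  have hRA : (0 : ℤ) ≤ (RA' κ Φ t p D mk : ℤ) := by positivity
  have hRAn : 2000 * (Neg.Kq κ : ℤ) * ((RA' κ Φ t p D mk : ℤ) + 2) ≤ (nL κ Φ t p D (gT mk gx κ Φ t p D) (fT mk fx κ Φ t p D) : ℤ) := by exact_mod_cast hnA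
  have hRAℓ : 22000 * (Neg.Kq κ : ℤ) * ((RA' κ Φ t p D mk : ℤ) + 2) ≤ (ℓL κ Φ t p D (gT mk gx κ Φ t p D) (fT mk fx κ Φ t p D) : ℤ) := by
    have h1 : ((22000 * Neg.Kq κ * (RA' κ Φ t p D mk + 2) : ℕ) : ℤ) ≤ (ML κ Φ t p D (gT mk gx κ Φ t p D) : ℤ) := by exact_mod_cast hMA
    have h2 := hN.ℓ_le
    push_cast at h1; linarith
  have hq0 : (0 : ℤ) ≤ (qB : ℤ) := by positivity
  have hq' : 4 * (qB : ℤ) ≤ (nL κ Φ t p D (gT mk gx κ Φ t p D) (fT mk fx κ Φ t p D) : ℤ) := by exact_mod_cast hq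
  have hN0 : (0 : ℤ) ≤ ((NrOfA κ Φ t p D (gT mk gx κ Φ t p D) (fT mk fx κ Φ t p D) σ y) : ℤ) := by positivity
  obtain ⟨hN', hcen⟩ := NrOfA_spec κ Φ t p D (gT mk gx κ Φ t p D) (fT mk fx κ Φ t p D) hN (σ := σ) (by rw [hσ]; simp) y hΛ
  have hN1 : ((NrOfA κ Φ t p D (gT mk gx κ Φ t p D) (fT mk fx κ Φ t p D) σ y) : ℤ) + 1 ≤ 1000 * (Neg.Kq κ : ℤ) := by
    have : ((0 + 1 + NrOfA κ Φ t p D (gT mk gx κ Φ t p D) (fT mk fx κ Φ t p D) σ y : ℕ) : ℤ) ≤ ((1000 * Neg.Kq κ : ℕ) : ℤ) := by exact_mod_cast hN'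
    push_cast at this; linarith
  subst hσ
  have ec : FcA κ Φ t p D (gT mk gx κ Φ t p D) (fT mk fx κ Φ t p D) y + (1) * u₀A κ Φ t p D (gT mk gx κ Φ t p D) (fT mk fx κ Φ t p D) * (((NrOfA κ Φ t p D (gT mk gx κ Φ t p D) (fT mk fx κ Φ t p D) 1 y) : ℤ) + 1) - (1) * (800 * (Neg.Kq κ : ℤ)) * u₀A κ Φ t p D (gT mk gx κ Φ t p D) (fT mk fx κ Φ t p D) =
      FcA κ Φ t p D (gT mk gx κ Φ t p D) (fT mk fx κ Φ t p D) y + u₀A κ Φ t p D (gT mk gx κ Φ t p D) (fT mk fx κ Φ t p D) * (((NrOfA κ Φ t p D (gT mk gx κ Φ t p D) (fT mk fx κ Φ t p D) 1 y) : ℤ) + 1) - 800 * (Neg.Kq κ : ℤ) * u₀A κ Φ t p D (gT mk gx κ Φ t p D) (fT mk fx κ Φ t p D) := by ring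
  rw [ec, FcA_eq_lit] at hcen
  unfold paLo paHi pbHi TwoAxis.Para.coarse
  rw [hc0, DofA_eq', (lam_eqA κ Φ t p D (gT mk gx κ Φ t p D) (fT mk fx κ Φ t p D) y).1]
  have e3 : -(5 * ((fcellsA κ Φ t p D (gT mk gx κ Φ t p D) (fT mk fx κ Φ t p D)).r 0 : ℤ)) + 1 = -(5 * (40 * (Neg.Kq κ : ℤ) * u₀A κ Φ t p D (gT mk gx κ Φ t p D) (fT mk fx κ Φ t p D))) + 1 := by rw [hr0]
  have e4 : 25 * ((fcellsA κ Φ t p D (gT mk gx κ Φ t p D) (fT mk fx κ Φ t p D)).r 0 : ℤ) - 1 = 25 * (40 * (Neg.Kq κ : ℤ) * u₀A κ Φ t p D (gT mk gx κ Φ t p D) (fT mk fx κ Φ t p D)) - 1 := by rw [hr0]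
  rw [e3, e4]
  exact RootArithA.prism_posA (A := Aof κ) (Q := (Neg.Kq κ : ℤ)) (u := u₀A κ Φ t p D (gT mk gx κ Φ t p D) (fT mk fx κ Φ t p D)) (Λ := Λ₀of κ Φ t p D (gT mk gx κ Φ t p D) (fT mk fx κ Φ t p D) y) hA2 hAe hKq hu0 hn hm hsu.1 hsu.2 hv hW hW0 hLb hLb0 hRA hRAn hRAℓ hq0 hq' hN0 hN1 hΛ hcen

/-- **`hPf₂`** (`σ = −1`). [cite: KozmaNitzan2024, §4 p. 28] -/
theorem hPf₂_RA (hN : EqNumL κ Φ t p D (gT mk gx κ Φ t p D) (fT mk fx κ Φ t p D)) (hκ : (hL κ Φ t p D (gT mk gx κ Φ t p D) (fT mk fx κ Φ t p D)).natAbs ≤ 10 * nL κ Φ t p D (gT mk gx κ Φ t p D) (fT mk fx κ Φ t p D))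
    (y : Site 2) (qB : ℕ) (hq : 4 * qB ≤ nL κ Φ t p D (gT mk gx κ Φ t p D) (fT mk fx κ Φ t p D))
    (hnA : 2000 * Neg.Kq κ * (RA' κ Φ t p D mk + 2) ≤ nL κ Φ t p D (gT mk gx κ Φ t p D) (fT mk fx κ Φ t p D)) (hMA : 22000 * Neg.Kq κ * (RA' κ Φ t p D mk + 2) ≤ ML κ Φ t p D (gT mk gx κ Φ t p D))
    (hΛ : |Λ₀of κ Φ t p D (gT mk gx κ Φ t p D) (fT mk fx κ Φ t p D) y| ≤ 3 * modulus (nL κ Φ t p D (gT mk gx κ Φ t p D) (fT mk fx κ Φ t p D)) (hL κ Φ t p D (gT mk gx κ Φ t p D) (fT mk fx κ Φ t p D)) (vL κ Φ t p D (gT mk gx κ Φ t p D) (fT mk fx κ Φ t p D)) (Skelφ.NegPrm.vβOf (nL κ Φ t p D (gT mk gx κ Φ t p D) (fT mk fx κ Φ t p D)) (hL κ Φ t p D (gT mk gx κ Φ t p D) (fT mk fx κ Φ t p D)) (ℓL κ Φ t p D (gT mk gx κ Φ t p D) (fT mk fx κ Φ t p D)) (vL κ Φ t p D (gT mk gx κ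 Φ t p D) (fT mk fx κ Φ t p D)))) {σ : ℤ} (hσ : σ = -1) :
    -(5 * ((fcellsA κ Φ t p D (gT mk gx κ Φ t p D) (fT mk fx κ Φ t p D)).r 0 : ℤ)) + 1 ≤
      -(TwoAxis.Para.coarse (20 * ((fcellsA κ Φ t p D (gT mk gx κ Φ t p D) (fT mk fx κ Φ t p D)).K : ℤ) * (((fcellsA κ Φ t p D (gT mk gx κ Φ t p D) (fT mk fx κ Φ t p D)).s 0 : ℕ) : ℤ)) (Skelφ.NegPrm.DofA (Aof κ) (nL κ Φ t p D (gT mk gx κ Φ t p D) (fT mk fx κ Φ t p D)) (hL κ Φ t p D (gT mk gx κ Φ t p D) (fT mk fx κ Φ t p D)) (ℓL κ Φ t p D (gT mk gx κ Φ t p D) (fT mk fx κ Φ t p D)) (vL κ Φ t p D (gT mk gx κ Φ t p D) (fT mk fx κ Φ t p D)) / 2) (Skelφ.NegPrm.DofA (Aof κ) (nL κ Φ t p D (gT mk gx κ Φ t p D) (fT mk fx κ Φ t p D)) (hL κ Φ t p D (gT mk gx κ Φ t p D) (fT mk fx κ Φ t p D)) (ℓL κ Φ t p D (gT mk gx κ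 Φ t p D) (fT mk fx κ Φ t p D)) (vL κ Φ t p D (gT mk gx κ Φ t p D) (fT mk fx κ Φ t p D))) (TwoAxis.Para.lam0 (Aof κ) (vL κ Φ t p D (gT mk gx κ Φ t p D) (fT mk fx κ Φ t p D)) (Skelφ.NegPrm.vβOf (nL κ Φ t p D (gT mk gx κ Φ t p D) (fT mk fx κ Φ t p D)) (hL κ Φ t p D (gT mk gx κ Φ t p D) (fT mk fx κ Φ t p D)) (ℓL κ Φ t p D (gT mk gx κ Φ t p D) (fT mk fx κ Φ t p D)) (vL κ Φ t p D (gT mk gx κ Φ t p D) (fT mk fx κ Φ t p D))) y) +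
        ((20 * ((fcellsA κ Φ t p D (gT mk gx κ Φ t p D) (fT mk fx κ Φ t p D)).K : ℤ) * (((fcellsA κ Φ t p D (gT mk gx κ Φ t p D) (fT mk fx κ Φ t p D)).s 0 : ℕ) : ℤ)) * (Aof κ * (modulus (nL κ Φ t p D (gT mk gx κ Φ t p D) (fT mk fx κ Φ t p D)) (hL κ Φ t p D (gT mk gx κ Φ t p D) (fT mk fx κ Φ t p D)) (vL κ Φ t p D (gT mk gx κ Φ t p D) (fT mk fx κ Φ t p D)) (Skelφ.NegPrm.vβOf (nL κ Φ t p D (gT mk gx κ Φ t p D) (fT mk fx κ Φ t p D)) (hL κ Φ t p D (gT mk gx κ Φ t p D) (fT mk fx κ Φ t p D)) (ℓL κ Φ t p D (gT mk gx κ Φ t p D) (fT mk fx κ Φ t p D)) (vL κ Φ t p D (gT mk gx κ Φ t p D) (fT mk fx κ Φ t p D))) * (max (σ * (paLo κ Φ t p D (gT mk gx κ Φ t p D) (fT mk fx κ Φ t p D) mk qB (NrOfA κ Φ t p D (gT mk gx κ Φ t p D) (fT mk fx κ Φ t p D) σ y))) (σ * (paHi κ Φ t p D (gT mk gx κ Φ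 t p D) (fT mk fx κ Φ t p D) mk qB (NrOfA κ Φ t p D (gT mk gx κ Φ t p D) (fT mk fx κ Φ t p D) σ y)))) -
          min ((vL κ Φ t p D (gT mk gx κ Φ t p D) (fT mk fx κ Φ t p D)) * ((shearUnit (nL κ Φ t p D (gT mk gx κ Φ t p D) (fT mk fx κ Φ t p D)) (hL κ Φ t p D (gT mk gx κ Φ t p D) (fT mk fx κ Φ t p D)) : ℤ) * (min (σ * (-pbHi κ Φ t p D (gT mk gx κ Φ t p D) (fT mk fx κ Φ t p D) mk (NrOfA κ Φ t p D (gT mk gx κ Φ t p D) (fT mk fx κ Φ t p D) σ y))) (σ * pbHi κ Φ t p D (gT mk gx κ Φ t p D) (fT mk fx κ Φ t p D) mk (NrOfA κ Φ t p D (gT mk gx κ Φ t p D) (fT mk fx κ Φ t p D) σ y)) - 1))) ((vL κ Φ t p D (gT mk gx κ Φ t p D) (fT mk fx κ Φ t p D)) * ((shearUnit (nL κ Φ t p D (gT mk gx κ Φ t p D) (fT mk fx κ Φ t p D)) (hL κ Φ t p D (gT mk gx κ Φ t p D) (fT mk fx κ Φ t p D)) : ℤ) * (max (σ * (-pbHi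 κ Φ t p D (gT mk gx κ Φ t p D) (fT mk fx κ Φ t p D) mk (NrOfA κ Φ t p D (gT mk gx κ Φ t p D) (fT mk fx κ Φ t p D) σ y))) (σ * pbHi κ Φ t p D (gT mk gx κ Φ t p D) (fT mk fx κ Φ t p D) mk (NrOfA κ Φ t p D (gT mk gx κ Φ t p D) (fT mk fx κ Φ t p D) σ y))) + (shearUnit (nL κ Φ t p D (gT mk gx κ Φ t p D) (fT mk fx κ Φ t p D)) (hL κ Φ t p D (gT mk gx κ Φ t p D) (fT mk fx κ Φ t p D)) : ℤ) - 1))) / (nL κ Φ t p D (gT mk gx κ Φ t p D) (fT mk fx κ Φ t p D) : ℤ))) / (Skelφ.NegPrm.DofA (Aof κ) (nL κ Φ t p D (gT mk gx κ Φ t p D) (fT mk fx κ Φ t p D)) (hL κ Φ t p D (gT mk gx κ Φ t p D) (fT mk fx κ Φ t p D)) (ℓL κ Φ t p D (gT mk gx κ Φ t p D) (fT mk fx κ Φ t p D)) (vL κ Φ t p D (gT mk gx κ Φ t p D) (fT mk fx κ Φ t p D))) + 1) ∧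
      -(TwoAxis.Para.coarse (20 * ((fcellsA κ Φ t p D (gT mk gx κ Φ t p D) (fT mk fx κ Φ t p D)).K : ℤ) * (((fcellsA κ Φ t p D (gT mk gx κ Φ t p D) (fT mk fx κ Φ t p D)).s 0 : ℕ) : ℤ)) (Skelφ.NegPrm.DofA (Aof κ) (nL κ Φ t p D (gT mk gx κ Φ t p D) (fT mk fx κ Φ t p D)) (hL κ Φ t p D (gT mk gx κ Φ t p D) (fT mk fx κ Φ t p D)) (ℓL κ Φ t p D (gT mk gx κ Φ t p D) (fT mk fx κ Φ t p D)) (vL κ Φ t p D (gT mk gx κ Φ t p D) (fT mk fx κ Φ t p D)) / 2) (Skelφ.NegPrm.DofA (Aof κ) (nL κ Φ t p D (gT mk gx κ Φ t p D) (fT mk fx κ Φ t p D)) (hL κ Φ t p D (gT mk gx κ Φ t p D) (fT mk fx κ Φ t p D)) (ℓL κ Φ t p D (gT mk gx κ Φ t p D) (fT mk fx κ Φ t p D)) (vL κ Φ t p D (gT mk gx κ Φ t p D) (fT mk fx κ Φ t p D))) (TwoAxis.Para.lam0 (Aof κ) (vL κ Φ t p D (gT mk gx κ Φ t p D) (fT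 mk fx κ Φ t p D)) (Skelφ.NegPrm.vβOf (nL κ Φ t p D (gT mk gx κ Φ t p D) (fT mk fx κ Φ t p D)) (hL κ Φ t p D (gT mk gx κ Φ t p D) (fT mk fx κ Φ t p D)) (ℓL κ Φ t p D (gT mk gx κ Φ t p D) (fT mk fx κ Φ t p D)) (vL κ Φ t p D (gT mk gx κ Φ t p D) (fT mk fx κ Φ t p D))) y) +
        ((20 * ((fcellsA κ Φ t p D (gT mk gx κ Φ t p D) (fT mk fx κ Φ t p D)).K : ℤ) * (((fcellsA κ Φ t p D (gT mk gx κ Φ t p D) (fT mk fx κ Φ t p D)).s 0 : ℕ) : ℤ)) * (Aof κ * (modulus (nL κ Φ t p D (gT mk gx κ Φ t p D) (fT mk fx κ Φ t p D)) (hL κ Φ t p D (gT mk gx κ Φ t p D) (fT mk fx κ Φ t p D)) (vL κ Φ t p D (gT mk gx κ Φ t p D) (fT mk fx κ Φ t p D)) (Skelφ.NegPrm.vβOf (nL κ Φ t p D (gT mk gx κ Φ t p D) (fT mk fx κ Φ t p D)) (hL κ Φ t p D (gT mk gx κ Φ t p D) (fT mk fx κ Φ t p D)) (ℓL κ Φ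 t p D (gT mk gx κ Φ t p D) (fT mk fx κ Φ t p D)) (vL κ Φ t p D (gT mk gx κ Φ t p D) (fT mk fx κ Φ t p D))) * (min (σ * (paLo κ Φ t p D (gT mk gx κ Φ t p D) (fT mk fx κ Φ t p D) mk qB (NrOfA κ Φ t p D (gT mk gx κ Φ t p D) (fT mk fx κ Φ t p D) σ y))) (σ * (paHi κ Φ t p D (gT mk gx κ Φ t p D) (fT mk fx κ Φ t p D) mk qB (NrOfA κ Φ t p D (gT mk gx κ Φ t p D) (fT mk fx κ Φ t p D) σ y)))) -
          max ((vL κ Φ t p D (gT mk gx κ Φ t p D) (fT mk fx κ Φ t p D)) * ((shearUnit (nL κ Φ t p D (gT mk gx κ Φ t p D) (fT mk fx κ Φ t p D)) (hL κ Φ t p D (gT mk gx κ Φ t p D) (fT mk fx κ Φ t p D)) : ℤ) * (min (σ * (-pbHi κ Φ t p D (gT mk gx κ Φ t p D) (fT mk fx κ Φ t p D) mk (NrOfA κ Φ t p D (gT mk gx κ Φ t p D) (fT mk fx κ Φ t p D) σ y))) (σ * pbHi κ Φ t p D (gT mk gx κ Φ t p D) (fT mk fx κ Φ t p D) mk (NrOfA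 κ Φ t p D (gT mk gx κ Φ t p D) (fT mk fx κ Φ t p D) σ y)) - 1))) ((vL κ Φ t p D (gT mk gx κ Φ t p D) (fT mk fx κ Φ t p D)) * ((shearUnit (nL κ Φ t p D (gT mk gx κ Φ t p D) (fT mk fx κ Φ t p D)) (hL κ Φ t p D (gT mk gx κ Φ t p D) (fT mk fx κ Φ t p D)) : ℤ) * (max (σ * (-pbHi κ Φ t p D (gT mk gx κ Φ t p D) (fT mk fx κ Φ t p D) mk (NrOfA κ Φ t p D (gT mk gx κ Φ t p D) (fT mk fx κ Φ t p D) σ y))) (σ * pbHi κ Φ t p D (gT mk gx κ Φ t p D) (fT mk fx κ Φ t p D) mk (NrOfA κ Φ t p D (gT mk gx κ Φ t p D) (fT mk fx κ Φ t p D) σ y))) + (shearUnit (nL κ Φ t p D (gT mk gx κ Φ t p D) (fT mk fx κ Φ t p D)) (hL κ Φ t p D (gT mk gx κ Φ t p D) (fT mk fx κ Φ t p D)) : ℤ) - 1))) / (nL κ Φ t p D (gT mk gx κ Φ t p D) (fT mk fx κ Φ t p D) : ℤ))) / (Skelφ.NegPrm.DofA (Aof κ) (nL κ Φ t p D (gT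 mk gx κ Φ t p D) (fT mk fx κ Φ t p D)) (hL κ Φ t p D (gT mk gx κ Φ t p D) (fT mk fx κ Φ t p D)) (ℓL κ Φ t p D (gT mk gx κ Φ t p D) (fT mk fx κ Φ t p D)) (vL κ Φ t p D (gT mk gx κ Φ t p D) (fT mk fx κ Φ t p D)))) ≤ 25 * ((fcellsA κ Φ t p D (gT mk gx κ Φ t p D) (fT mk fx κ Φ t p D)).r 0 : ℤ) - 1 := by
  obtain ⟨hn1, hℓ1⟩ := one_le_of_eqNumL κ Φ t p D _ _ hN
  have hm0 := (Skelφ.NegPrm.modulus_vβOf hn1 (hL κ Φ t p D (gT mk gx κ Φ t p D) (fT mk fx κ Φ t p D)) (ℓL κ Φ t p D (gT mk gx κ Φ t p D) (fT mk fx κ Φ t p D)) (vL κ Φ t p D (gT mk gx κ Φ t p D) (fT mk fx κ Φ t p D))).1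
  have hm : (nL κ Φ t p D (gT mk gx κ Φ t p D) (fT mk fx κ Φ t p D) : ℤ) * ((ℓL κ Φ t p D (gT mk gx κ Φ t p D) (fT mk fx κ Φ t p D) : ℤ) - 1) < modulus (nL κ Φ t p D (gT mk gx κ Φ t p D) (fT mk fx κ Φ t p D)) (hL κ Φ t p D (gT mk gx κ Φ t p D) (fT mk fx κ Φ t p D)) (vL κ Φ t p D (gT mk gx κ Φ t p D) (fT mk fx κ Φ t p D)) (Skelφ.NegPrm.vβOf (nL κ Φ t p D (gT mk gx κ Φ t p D) (fT mk fx κ Φ t p D)) (hL κ Φ t p D (gT mk gx κ Φ t p D) (fT mk fx κ Φ t p D)) (ℓL κ Φ t p D (gT mk gx κ Φ t p D) (fT mk fx κ Φ t p D)) (vL κ Φ t p D (gT mk gx κ Φ t p D) (fT mk fx κ Φ t p D))) := by linarith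
  obtain ⟨hc0, hc1, hr0, hr1, hb0, hb1, hu0, hu1⟩ := units_eqA κ Φ t p D (gT mk gx κ Φ t p D) (fT mk fx κ Φ t p D)
  have hA2 : (2 : ℤ) ≤ Aof κ := by have := le_Aof κ; linarith
  have hAe : (2 : ℤ) ∣ Aof κ := ⟨10 * (Neg.K κ : ℤ), by rw [Aof_eq_K]; ring⟩
  have hKq : (1 : ℤ) ≤ (Neg.Kq κ : ℤ) := by exact_mod_cast Neg.one_le_Kq κ
  have hv : |(vL κ Φ t p D (gT mk gx κ Φ t p D) (fT mk fx κ Φ t p D))| ≤ (nL κ Φ t p D (gT mk gx κ Φ t p D) (fT mk fx κ Φ t p D) : ℤ) := hN.v_le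
  have hn : (1 : ℤ) ≤ (nL κ Φ t p D (gT mk gx κ Φ t p D) (fT mk fx κ Φ t p D) : ℤ) := by exact_mod_cast hn1
  have hsu : (nL κ Φ t p D (gT mk gx κ Φ t p D) (fT mk fx κ Φ t p D) : ℤ) ≤ (shearUnit (nL κ Φ t p D (gT mk gx κ Φ t p D) (fT mk fx κ Φ t p D)) (hL κ Φ t p D (gT mk gx κ Φ t p D) (fT mk fx κ Φ t p D)) : ℤ) ∧ (shearUnit (nL κ Φ t p D (gT mk gx κ Φ t p D) (fT mk fx κ Φ t p D)) (hL κ Φ t p D (gT mk gx κ Φ t p D) (fT mk fx κ Φ t p D)) : ℤ) ≤ 11 * (nL κ Φ t p D (gT mk gx κ Φ t p D) (fT mk fx κ Φ t p D) : ℤ) := by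
    have h10 : (((hL κ Φ t p D (gT mk gx κ Φ t p D) (fT mk fx κ Φ t p D))).natAbs : ℤ) ≤ 10 * (nL κ Φ t p D (gT mk gx κ Φ t p D) (fT mk fx κ Φ t p D) : ℤ) := by exact_mod_cast hκ
    have h0 : (0 : ℤ) ≤ (((hL κ Φ t p D (gT mk gx κ Φ t p D) (fT mk fx κ Φ t p D))).natAbs : ℤ) := by positivity
    unfold Skelφ.shearUnit
    simp only [Nat.cast_add]
    constructor <;> linarith
  obtain ⟨hW, hLb⟩ := Wrun_spec κ Φ t p D (gT mk gx κ Φ t p D) (fT mk fx κ Φ t p D) hn1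
  have hW0 : (0 : ℤ) ≤ (Wrun κ Φ t p D (gT mk gx κ Φ t p D) (fT mk fx κ Φ t p D) : ℤ) := by positivity
  have hLb0 : (0 : ℤ) ≤ (Lbrun κ Φ t p D (gT mk gx κ Φ t p D) (fT mk fx κ Φ t p D) : ℤ) := by positivity
  have hRA : (0 : ℤ) ≤ (RA' κ Φ t p D mk : ℤ) := by positivity
  have hRAn : 2000 * (Neg.Kq κ : ℤ) * ((RA' κ Φ t p D mk : ℤ) + 2) ≤ (nL κ Φ t p D (gT mk gx κ Φ t p D) (fT mk fx κ Φ t p D) : ℤ) := by exact_mod_cast hnA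
  have hRAℓ : 22000 * (Neg.Kq κ : ℤ) * ((RA' κ Φ t p D mk : ℤ) + 2) ≤ (ℓL κ Φ t p D (gT mk gx κ Φ t p D) (fT mk fx κ Φ t p D) : ℤ) := by
    have h1 : ((22000 * Neg.Kq κ * (RA' κ Φ t p D mk + 2) : ℕ) : ℤ) ≤ (ML κ Φ t p D (gT mk gx κ Φ t p D) : ℤ) := by exact_mod_cast hMA
    have h2 := hN.ℓ_le
    push_cast at h1; linarith
  have hq0 : (0 : ℤ) ≤ (qB : ℤ) := by positivity
  have hq' : 4 * (qB : ℤ) ≤ (nL κ Φ t p D (gT mk gx κ Φ t p D) (fT mk fx κ Φ t p D) : ℤ) := by exact_mod_cast hq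
  have hN0 : (0 : ℤ) ≤ ((NrOfA κ Φ t p D (gT mk gx κ Φ t p D) (fT mk fx κ Φ t p D) σ y) : ℤ) := by positivity
  obtain ⟨hN', hcen⟩ := NrOfA_spec κ Φ t p D (gT mk gx κ Φ t p D) (fT mk fx κ Φ t p D) hN (σ := σ) (by rw [hσ]; simp) y hΛ
  have hN1 : ((NrOfA κ Φ t p D (gT mk gx κ Φ t p D) (fT mk fx κ Φ t p D) σ y) : ℤ) + 1 ≤ 1000 * (Neg.Kq κ : ℤ) := by
    have : ((0 + 1 + NrOfA κ Φ t p D (gT mk gx κ Φ t p D) (fT mk fx κ Φ t p D) σ y : ℕ) : ℤ) ≤ ((1000 * Neg.Kq κ : ℕ) : ℤ) := by exact_mod_cast hN'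
    push_cast at this; linarith
  subst hσ
  have ec : FcA κ Φ t p D (gT mk gx κ Φ t p D) (fT mk fx κ Φ t p D) y + (-1) * u₀A κ Φ t p D (gT mk gx κ Φ t p D) (fT mk fx κ Φ t p D) * (((NrOfA κ Φ t p D (gT mk gx κ Φ t p D) (fT mk fx κ Φ t p D) (-1) y) : ℤ) + 1) - (-1) * (800 * (Neg.Kq κ : ℤ)) * u₀A κ Φ t p D (gT mk gx κ Φ t p D) (fT mk fx κ Φ t p D) =
      FcA κ Φ t p D (gT mk gx κ Φ t p D) (fT mk fx κ Φ t p D) y - u₀A κ Φ t p D (gT mk gx κ Φ t p D) (fT mk fx κ Φ t p D) * (((NrOfA κ Φ t p D (gT mk gx κ Φ t p D) (fT mk fx κ Φ t p D) (-1) y) : ℤ) + 1) + 800 * (Neg.Kq κ : ℤ) * u₀A κ Φ t p D (gT mk gx κ Φ t p D) (fT mk fx κ Φ t p D) := by ring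
  rw [ec, FcA_eq_lit] at hcen
  unfold paLo paHi pbHi TwoAxis.Para.coarse
  rw [hc0, DofA_eq', (lam_eqA κ Φ t p D (gT mk gx κ Φ t p D) (fT mk fx κ Φ t p D) y).1]
  have e3 : -(5 * ((fcellsA κ Φ t p D (gT mk gx κ Φ t p D) (fT mk fx κ Φ t p D)).r 0 : ℤ)) + 1 = -(5 * (40 * (Neg.Kq κ : ℤ) * u₀A κ Φ t p D (gT mk gx κ Φ t p D) (fT mk fx κ Φ t p D))) + 1 := by rw [hr0]
  have e4 : 25 * ((fcellsA κ Φ t p D (gT mk gx κ Φ t p D) (fT mk fx κ Φ t p D)).r 0 : ℤ) - 1 = 25 * (40 * (Neg.Kq κ : ℤ) * u₀A κ Φ t p D (gT mk gx κ Φ t p D) (fT mk fx κ Φ t p D)) - 1 := by rw [hr0]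
  rw [e3, e4]
  exact RootArithA.prism_negA (A := Aof κ) (Q := (Neg.Kq κ : ℤ)) (u := u₀A κ Φ t p D (gT mk gx κ Φ t p D) (fT mk fx κ Φ t p D)) (Λ := Λ₀of κ Φ t p D (gT mk gx κ Φ t p D) (fT mk fx κ Φ t p D) y) hA2 hAe hKq hu0 hn hm hsu.1 hsu.2 hv hW hW0 hLb hLb0 hRA hRAn hRAℓ hq0 hq' hN0 hN1 hΛ hcen

/-- **`hLg₃`** (across, either `σ`): the last core's fine ordinate inside `±(b0T₁ − 1)`. [cite: KozmaNitzan2024, §4 Lemma 11 (p. 22)] -/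
theorem hLg₃_RA (hN : EqNumL κ Φ t p D (gT mk gx κ Φ t p D) (fT mk fx κ Φ t p D)) (hκ : (hL κ Φ t p D (gT mk gx κ Φ t p D) (fT mk fx κ Φ t p D)).natAbs ≤ 10 * nL κ Φ t p D (gT mk gx κ Φ t p D) (fT mk fx κ Φ t p D))
    (y : Site 2) (qB : ℕ) (hq : 4 * qB ≤ nL κ Φ t p D (gT mk gx κ Φ t p D) (fT mk fx κ Φ t p D))
    (hnA : 2000 * Neg.Kq κ * (RA' κ Φ t p D mk + 2) ≤ nL κ Φ t p D (gT mk gx κ Φ t p D) (fT mk fx κ Φ t p D)) (hMA : 22000 * Neg.Kq κ * (RA' κ Φ t p D mk + 2) ≤ ML κ Φ t p D (gT mk gx κ Φ t p D))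
    (hΛ : |Λ₀of κ Φ t p D (gT mk gx κ Φ t p D) (fT mk fx κ Φ t p D) y| ≤ 3 * modulus (nL κ Φ t p D (gT mk gx κ Φ t p D) (fT mk fx κ Φ t p D)) (hL κ Φ t p D (gT mk gx κ Φ t p D) (fT mk fx κ Φ t p D)) (vL κ Φ t p D (gT mk gx κ Φ t p D) (fT mk fx κ Φ t p D)) (Skelφ.NegPrm.vβOf (nL κ Φ t p D (gT mk gx κ Φ t p D) (fT mk fx κ Φ t p D)) (hL κ Φ t p D (gT mk gx κ Φ t p D) (fT mk fx κ Φ t p D)) (ℓL κ Φ t p D (gT mk gx κ Φ t p D) (fT mk fx κ Φ t p D)) (vL κ Φ t p D (gT mk gx κ Φ t p D) (fT mk fx κ Φ t p D)))) (hΛ₁ : |Λ₁of κ Φ t p D (gT mk gx κ Φ t p D) (fT mk fx κ Φ t p D) y| ≤ 2 * modulus (nL κ Φ t p D (gT mk gx κ Φ t p D) (fT mk fx κ Φ t p D)) (hL κ Φ t p D (gT mk gx κ Φ t p D) (fT mk fx κ Φ t p D)) (vL κ Φ t p D (gT mk gx κ Φ t p D) (fT mk fx κ Φ t p D)) (Skelφ.NegPrm.vβOf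 (nL κ Φ t p D (gT mk gx κ Φ t p D) (fT mk fx κ Φ t p D)) (hL κ Φ t p D (gT mk gx κ Φ t p D) (fT mk fx κ Φ t p D)) (ℓL κ Φ t p D (gT mk gx κ Φ t p D) (fT mk fx κ Φ t p D)) (vL κ Φ t p D (gT mk gx κ Φ t p D) (fT mk fx κ Φ t p D)))) {σ : ℤ} (hσ : σ = 1 ∨ σ = -1) :
    -((b0TA κ Φ t p D (gT mk gx κ Φ t p D) (fT mk fx κ Φ t p D) 1 : ℤ) - 1) ≤ TwoAxis.Para.coarse (20 * ((fcellsA κ Φ t p D (gT mk gx κ Φ t p D) (fT mk fx κ Φ t p D)).K : ℤ) * (((fcellsA κ Φ t p D (gT mk gx κ Φ t p D) (fT mk fx κ Φ t p D)).s 1 : ℕ) : ℤ)) (Skelφ.NegPrm.DofA (Aof κ) (nL κ Φ t p D (gT mk gx κ Φ t p D) (fT mk fx κ Φ t p D)) (hL κ Φ t p D (gT mk gx κ Φ t p D) (fT mk fx κ Φ t p D)) (ℓL κ Φ t p D (gT mk gx κ Φ t p D) (fT mk fx κ Φ t p D)) (vL κ Φ t p D (gT mk gx κ Φ t p D) (fT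 mk fx κ Φ t p D)) / 2) (Skelφ.NegPrm.DofA (Aof κ) (nL κ Φ t p D (gT mk gx κ Φ t p D) (fT mk fx κ Φ t p D)) (hL κ Φ t p D (gT mk gx κ Φ t p D) (fT mk fx κ Φ t p D)) (ℓL κ Φ t p D (gT mk gx κ Φ t p D) (fT mk fx κ Φ t p D)) (vL κ Φ t p D (gT mk gx κ Φ t p D) (fT mk fx κ Φ t p D))) (TwoAxis.Para.lam1 (Aof κ) (nL κ Φ t p D (gT mk gx κ Φ t p D) (fT mk fx κ Φ t p D) : ℤ) (hL κ Φ t p D (gT mk gx κ Φ t p D) (fT mk fx κ Φ t p D)) y) + ((20 * ((fcellsA κ Φ t p D (gT mk gx κ Φ t p D) (fT mk fx κ Φ t p D)).K : ℤ) * (((fcellsA κ Φ t p D (gT mk gx κ Φ t p D) (fT mk fx κ Φ t p D)).s 1 : ℕ) : ℤ)) * (Aof κ * ((shearUnit (nL κ Φ t p D (gT mk gx κ Φ t p D) (fT mk fx κ Φ t p D)) (hL κ Φ t p D (gT mk gx κ Φ t p D) (fT mk fx κ Φ t p D)) : ℤ) * (min (σ * (-lbHi κ Φ t p D (gT mk gx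 κ Φ t p D) (fT mk fx κ Φ t p D) mk (NrOfA κ Φ t p D (gT mk gx κ Φ t p D) (fT mk fx κ Φ t p D) σ y))) (σ * lbHi κ Φ t p D (gT mk gx κ Φ t p D) (fT mk fx κ Φ t p D) mk (NrOfA κ Φ t p D (gT mk gx κ Φ t p D) (fT mk fx κ Φ t p D) σ y)) - 1)))) / (Skelφ.NegPrm.DofA (Aof κ) (nL κ Φ t p D (gT mk gx κ Φ t p D) (fT mk fx κ Φ t p D)) (hL κ Φ t p D (gT mk gx κ Φ t p D) (fT mk fx κ Φ t p D)) (ℓL κ Φ t p D (gT mk gx κ Φ t p D) (fT mk fx κ Φ t p D)) (vL κ Φ t p D (gT mk gx κ Φ t p D) (fT mk fx κ Φ t p D))) ∧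
      TwoAxis.Para.coarse (20 * ((fcellsA κ Φ t p D (gT mk gx κ Φ t p D) (fT mk fx κ Φ t p D)).K : ℤ) * (((fcellsA κ Φ t p D (gT mk gx κ Φ t p D) (fT mk fx κ Φ t p D)).s 1 : ℕ) : ℤ)) (Skelφ.NegPrm.DofA (Aof κ) (nL κ Φ t p D (gT mk gx κ Φ t p D) (fT mk fx κ Φ t p D)) (hL κ Φ t p D (gT mk gx κ Φ t p D) (fT mk fx κ Φ t p D)) (ℓL κ Φ t p D (gT mk gx κ Φ t p D) (fT mk fx κ Φ t p D)) (vL κ Φ t p D (gT mk gx κ Φ t p D) (fT mk fx κ Φ t p D)) / 2) (Skelφ.NegPrm.DofA (Aof κ) (nL κ Φ t p D (gT mk gx κ Φ t p D) (fT mk fx κ Φ t p D)) (hL κ Φ t p D (gT mk gx κ Φ t p D) (fT mk fx κ Φ t p D)) (ℓL κ Φ t p D (gT mk gx κ Φ t p D) (fT mk fx κ Φ t p D)) (vL κ Φ t p D (gT mk gx κ Φ t p D) (fT mk fx κ Φ t p D))) (TwoAxis.Para.lam1 (Aof κ) (nL κ Φ t p D (gT mk gx κ Φ t p D) (fT mk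 fx κ Φ t p D) : ℤ) (hL κ Φ t p D (gT mk gx κ Φ t p D) (fT mk fx κ Φ t p D)) y) +
        ((20 * ((fcellsA κ Φ t p D (gT mk gx κ Φ t p D) (fT mk fx κ Φ t p D)).K : ℤ) * (((fcellsA κ Φ t p D (gT mk gx κ Φ t p D) (fT mk fx κ Φ t p D)).s 1 : ℕ) : ℤ)) * (Aof κ * ((shearUnit (nL κ Φ t p D (gT mk gx κ Φ t p D) (fT mk fx κ Φ t p D)) (hL κ Φ t p D (gT mk gx κ Φ t p D) (fT mk fx κ Φ t p D)) : ℤ) * (max (σ * (-lbHi κ Φ t p D (gT mk gx κ Φ t p D) (fT mk fx κ Φ t p D) mk (NrOfA κ Φ t p D (gT mk gx κ Φ t p D) (fT mk fx κ Φ t p D) σ y))) (σ * lbHi κ Φ t p D (gT mk gx κ Φ t p D) (fT mk fx κ Φ t p D) mk (NrOfA κ Φ t p D (gT mk gx κ Φ t p D) (fT mk fx κ Φ t p D) σ y))) + (shearUnit (nL κ Φ t p D (gT mk gx κ Φ t p D) (fT mk fx κ Φ t p D)) (hL κ Φ t p D (gT mk gx κ Φ t p D) (fT mk fx κ Φ t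 p D)) : ℤ) - 1))) / (Skelφ.NegPrm.DofA (Aof κ) (nL κ Φ t p D (gT mk gx κ Φ t p D) (fT mk fx κ Φ t p D)) (hL κ Φ t p D (gT mk gx κ Φ t p D) (fT mk fx κ Φ t p D)) (ℓL κ Φ t p D (gT mk gx κ Φ t p D) (fT mk fx κ Φ t p D)) (vL κ Φ t p D (gT mk gx κ Φ t p D) (fT mk fx κ Φ t p D))) + 1 ≤
        (b0TA κ Φ t p D (gT mk gx κ Φ t p D) (fT mk fx κ Φ t p D) 1 : ℤ) - 1 := by
  obtain ⟨hn1, hℓ1⟩ := one_le_of_eqNumL κ Φ t p D _ _ hN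
  have hm0 := (Skelφ.NegPrm.modulus_vβOf hn1 (hL κ Φ t p D (gT mk gx κ Φ t p D) (fT mk fx κ Φ t p D)) (ℓL κ Φ t p D (gT mk gx κ Φ t p D) (fT mk fx κ Φ t p D)) (vL κ Φ t p D (gT mk gx κ Φ t p D) (fT mk fx κ Φ t p D))).1
  have hm : (nL κ Φ t p D (gT mk gx κ Φ t p D) (fT mk fx κ Φ t p D) : ℤ) * ((ℓL κ Φ t p D (gT mk gx κ Φ t p D) (fT mk fx κ Φ t p D) : ℤ) - 1) < modulus (nL κ Φ t p D (gT mk gx κ Φ t p D) (fT mk fx κ Φ t p D)) (hL κ Φ t p D (gT mk gx κ Φ t p D) (fT mk fx κ Φ t p D)) (vL κ Φ t p D (gT mk gx κ Φ t p D) (fT mk fx κ Φ t p D)) (Skelφ.NegPrm.vβOf (nL κ Φ t p D (gT mk gx κ Φ t p D) (fT mk fx κ Φ t p D)) (hL κ Φ t p D (gT mk gx κ Φ t p D) (fT mk fx κ Φ t p D)) (ℓL κ Φ t p D (gT mk gx κ Φ t p D) (fT mk fx κ Φ t p D)) (vL κ Φ t p D (gT mk gx κ Φ t p D) (fT mk fx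 κ Φ t p D))) := by linarith
  obtain ⟨hc0, hc1, hr0, hr1, hb0, hb1, hu0, hu1⟩ := units_eqA κ Φ t p D (gT mk gx κ Φ t p D) (fT mk fx κ Φ t p D)
  have hA2 : (2 : ℤ) ≤ Aof κ := by have := le_Aof κ; linarith
  have hAe : (2 : ℤ) ∣ Aof κ := ⟨10 * (Neg.K κ : ℤ), by rw [Aof_eq_K]; ring⟩
  have hKq : (1 : ℤ) ≤ (Neg.Kq κ : ℤ) := by exact_mod_cast Neg.one_le_Kq κ
  have hv : |(vL κ Φ t p D (gT mk gx κ Φ t p D) (fT mk fx κ Φ t p D))| ≤ (nL κ Φ t p D (gT mk gx κ Φ t p D) (fT mk fx κ Φ t p D) : ℤ) := hN.v_le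
  have hn : (1 : ℤ) ≤ (nL κ Φ t p D (gT mk gx κ Φ t p D) (fT mk fx κ Φ t p D) : ℤ) := by exact_mod_cast hn1
  have hsu : (nL κ Φ t p D (gT mk gx κ Φ t p D) (fT mk fx κ Φ t p D) : ℤ) ≤ (shearUnit (nL κ Φ t p D (gT mk gx κ Φ t p D) (fT mk fx κ Φ t p D)) (hL κ Φ t p D (gT mk gx κ Φ t p D) (fT mk fx κ Φ t p D)) : ℤ) ∧ (shearUnit (nL κ Φ t p D (gT mk gx κ Φ t p D) (fT mk fx κ Φ t p D)) (hL κ Φ t p D (gT mk gx κ Φ t p D) (fT mk fx κ Φ t p D)) : ℤ) ≤ 11 * (nL κ Φ t p D (gT mk gx κ Φ t p D) (fT mk fx κ Φ t p D) : ℤ) := by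
    have h10 : (((hL κ Φ t p D (gT mk gx κ Φ t p D) (fT mk fx κ Φ t p D))).natAbs : ℤ) ≤ 10 * (nL κ Φ t p D (gT mk gx κ Φ t p D) (fT mk fx κ Φ t p D) : ℤ) := by exact_mod_cast hκ
    have h0 : (0 : ℤ) ≤ (((hL κ Φ t p D (gT mk gx κ Φ t p D) (fT mk fx κ Φ t p D))).natAbs : ℤ) := by positivity
    unfold Skelφ.shearUnit
    simp only [Nat.cast_add]
    constructor <;> linarith
  obtain ⟨hW, hLb⟩ := Wrun_spec κ Φ t p D (gT mk gx κ Φ t p D) (fT mk fx κ Φ t p D) hn1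
  have hW0 : (0 : ℤ) ≤ (Wrun κ Φ t p D (gT mk gx κ Φ t p D) (fT mk fx κ Φ t p D) : ℤ) := by positivity
  have hLb0 : (0 : ℤ) ≤ (Lbrun κ Φ t p D (gT mk gx κ Φ t p D) (fT mk fx κ Φ t p D) : ℤ) := by positivity
  have hRA : (0 : ℤ) ≤ (RA' κ Φ t p D mk : ℤ) := by positivity
  have hRAn : 2000 * (Neg.Kq κ : ℤ) * ((RA' κ Φ t p D mk : ℤ) + 2) ≤ (nL κ Φ t p D (gT mk gx κ Φ t p D) (fT mk fx κ Φ t p D) : ℤ) := by exact_mod_cast hnA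
  have hRAℓ : 22000 * (Neg.Kq κ : ℤ) * ((RA' κ Φ t p D mk : ℤ) + 2) ≤ (ℓL κ Φ t p D (gT mk gx κ Φ t p D) (fT mk fx κ Φ t p D) : ℤ) := by
    have h1 : ((22000 * Neg.Kq κ * (RA' κ Φ t p D mk + 2) : ℕ) : ℤ) ≤ (ML κ Φ t p D (gT mk gx κ Φ t p D) : ℤ) := by exact_mod_cast hMA
    have h2 := hN.ℓ_le
    push_cast at h1; linarith
  have hq0 : (0 : ℤ) ≤ (qB : ℤ) := by positivity
  have hq' : 4 * (qB : ℤ) ≤ (nL κ Φ t p D (gT mk gx κ Φ t p D) (fT mk fx κ Φ t p D) : ℤ) := by exact_mod_cast hq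
  have hN0 : (0 : ℤ) ≤ ((NrOfA κ Φ t p D (gT mk gx κ Φ t p D) (fT mk fx κ Φ t p D) σ y) : ℤ) := by positivity
  obtain ⟨hN', -⟩ := NrOfA_spec κ Φ t p D (gT mk gx κ Φ t p D) (fT mk fx κ Φ t p D) hN hσ y hΛ
  have hN1 : ((NrOfA κ Φ t p D (gT mk gx κ Φ t p D) (fT mk fx κ Φ t p D) σ y) : ℤ) + 1 ≤ 1000 * (Neg.Kq κ : ℤ) := by
    have : ((0 + 1 + NrOfA κ Φ t p D (gT mk gx κ Φ t p D) (fT mk fx κ Φ t p D) σ y : ℕ) : ℤ) ≤ ((1000 * Neg.Kq κ : ℕ) : ℤ) := by exact_mod_cast hN'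
    push_cast at this; linarith
  unfold lbHi TwoAxis.Para.coarse
  rw [hc1, DofA_eq', (lam_eqA κ Φ t p D (gT mk gx κ Φ t p D) (fT mk fx κ Φ t p D) y).2]
  have e1 : -((b0TA κ Φ t p D (gT mk gx κ Φ t p D) (fT mk fx κ Φ t p D) 1 : ℤ) - 1) = -(10 * (Neg.Kq κ : ℤ) * u₁A κ Φ t p D (gT mk gx κ Φ t p D) (fT mk fx κ Φ t p D) - 1) := by rw [hb1]
  have e2 : (b0TA κ Φ t p D (gT mk gx κ Φ t p D) (fT mk fx κ Φ t p D) 1 : ℤ) - 1 = 10 * (Neg.Kq κ : ℤ) * u₁A κ Φ t p D (gT mk gx κ Φ t p D) (fT mk fx κ Φ t p D) - 1 := by rw [hb1]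
  rw [e1, e2]
  exact RootArithA.trans_lastA (A := Aof κ) (Q := (Neg.Kq κ : ℤ)) (u := u₁A κ Φ t p D (gT mk gx κ Φ t p D) (fT mk fx κ Φ t p D)) (Λ := Λ₁of κ Φ t p D (gT mk gx κ Φ t p D) (fT mk fx κ Φ t p D) y) hA2 hAe hKq hu1 hn hm hsu.1 hsu.2 hW hW0 hRA hRAℓ hN0 hN1 hσ hΛ₁

/-- **`hPf₃`** (across, either `σ`): the run prism's fine ordinate inside `±(5r₁ − 2)`. [cite: KozmaNitzan2024, §4 p. 28] -/
theorem hPf₃_RA (hN : EqNumL κ Φ t p D (gT mk gx κ Φ t p D) (fT mk fx κ Φ t p D)) (hκ : (hL κ Φ t p D (gT mk gx κ Φ t p D) (fT mk fx κ Φ t p D)).natAbs ≤ 10 * nL κ Φ t p D (gT mk gx κ Φ t p D) (fT mk fx κ Φ t p D))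
    (y : Site 2) (qB : ℕ) (hq : 4 * qB ≤ nL κ Φ t p D (gT mk gx κ Φ t p D) (fT mk fx κ Φ t p D))
    (hnA : 2000 * Neg.Kq κ * (RA' κ Φ t p D mk + 2) ≤ nL κ Φ t p D (gT mk gx κ Φ t p D) (fT mk fx κ Φ t p D)) (hMA : 22000 * Neg.Kq κ * (RA' κ Φ t p D mk + 2) ≤ ML κ Φ t p D (gT mk gx κ Φ t p D))
    (hΛ : |Λ₀of κ Φ t p D (gT mk gx κ Φ t p D) (fT mk fx κ Φ t p D) y| ≤ 3 * modulus (nL κ Φ t p D (gT mk gx κ Φ t p D) (fT mk fx κ Φ t p D)) (hL κ Φ t p D (gT mk gx κ Φ t p D) (fT mk fx κ Φ t p D)) (vL κ Φ t p D (gT mk gx κ Φ t p D) (fT mk fx κ Φ t p D)) (Skelφ.NegPrm.vβOf (nL κ Φ t p D (gT mk gx κ Φ t p D) (fT mk fx κ Φ t p D)) (hL κ Φ t p D (gT mk gx κ Φ t p D) (fT mk fx κ Φ t p D)) (ℓL κ Φ t p D (gT mk gx κ Φ t p D) (fT mk fx κ Φ t p D)) (vL κ Φ t p D (gT mk gx κ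 Φ t p D) (fT mk fx κ Φ t p D)))) (hΛ₁ : |Λ₁of κ Φ t p D (gT mk gx κ Φ t p D) (fT mk fx κ Φ t p D) y| ≤ 2 * modulus (nL κ Φ t p D (gT mk gx κ Φ t p D) (fT mk fx κ Φ t p D)) (hL κ Φ t p D (gT mk gx κ Φ t p D) (fT mk fx κ Φ t p D)) (vL κ Φ t p D (gT mk gx κ Φ t p D) (fT mk fx κ Φ t p D)) (Skelφ.NegPrm.vβOf (nL κ Φ t p D (gT mk gx κ Φ t p D) (fT mk fx κ Φ t p D)) (hL κ Φ t p D (gT mk gx κ Φ t p D) (fT mk fx κ Φ t p D)) (ℓL κ Φ t p D (gT mk gx κ Φ t p D) (fT mk fx κ Φ t p D)) (vL κ Φ t p D (gT mk gx κ Φ t p D) (fT mk fx κ Φ t p D)))) {σ : ℤ} (hσ : σ = 1 ∨ σ = -1) :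
    -(5 * ((fcellsA κ Φ t p D (gT mk gx κ Φ t p D) (fT mk fx κ Φ t p D)).r 1 : ℤ) - 2) ≤ TwoAxis.Para.coarse (20 * ((fcellsA κ Φ t p D (gT mk gx κ Φ t p D) (fT mk fx κ Φ t p D)).K : ℤ) * (((fcellsA κ Φ t p D (gT mk gx κ Φ t p D) (fT mk fx κ Φ t p D)).s 1 : ℕ) : ℤ)) (Skelφ.NegPrm.DofA (Aof κ) (nL κ Φ t p D (gT mk gx κ Φ t p D) (fT mk fx κ Φ t p D)) (hL κ Φ t p D (gT mk gx κ Φ t p D) (fT mk fx κ Φ t p D)) (ℓL κ Φ t p D (gT mk gx κ Φ t p D) (fT mk fx κ Φ t p D)) (vL κ Φ t p D (gT mk gx κ Φ t p D) (fT mk fx κ Φ t p D)) / 2) (Skelφ.NegPrm.DofA (Aof κ) (nL κ Φ t p D (gT mk gx κ Φ t p D) (fT mk fx κ Φ t p D)) (hL κ Φ t p D (gT mk gx κ Φ t p D) (fT mk fx κ Φ t p D)) (ℓL κ Φ t p D (gT mk gx κ Φ t p D) (fT mk fx κ Φ t p D)) (vL κ Φ t p D (gT mk gx κ Φ t p D)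 (fT mk fx κ Φ t p D))) (TwoAxis.Para.lam1 (Aof κ) (nL κ Φ t p D (gT mk gx κ Φ t p D) (fT mk fx κ Φ t p D) : ℤ) (hL κ Φ t p D (gT mk gx κ Φ t p D) (fT mk fx κ Φ t p D)) y) + ((20 * ((fcellsA κ Φ t p D (gT mk gx κ Φ t p D) (fT mk fx κ Φ t p D)).K : ℤ) * (((fcellsA κ Φ t p D (gT mk gx κ Φ t p D) (fT mk fx κ Φ t p D)).s 1 : ℕ) : ℤ)) * (Aof κ * ((shearUnit (nL κ Φ t p D (gT mk gx κ Φ t p D) (fT mk fx κ Φ t p D)) (hL κ Φ t p D (gT mk gx κ Φ t p D) (fT mk fx κ Φ t p D)) : ℤ) * (min (σ * (-pbHi κ Φ t p D (gT mk gx κ Φ t p D) (fT mk fx κ Φ t p D) mk (NrOfA κ Φ t p D (gT mk gx κ Φ t p D) (fT mk fx κ Φ t p D) σ y))) (σ * pbHi κ Φ t p D (gT mk gx κ Φ t p D) (fT mk fx κ Φ t p D) mk (NrOfA κ Φ t p D (gT mk gx κ Φ t p D) (fT mk fx κ Φ t p D) σ y)) - 1)))) / (Skelφ.NegPrm.DofA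 (Aof κ) (nL κ Φ t p D (gT mk gx κ Φ t p D) (fT mk fx κ Φ t p D)) (hL κ Φ t p D (gT mk gx κ Φ t p D) (fT mk fx κ Φ t p D)) (ℓL κ Φ t p D (gT mk gx κ Φ t p D) (fT mk fx κ Φ t p D)) (vL κ Φ t p D (gT mk gx κ Φ t p D) (fT mk fx κ Φ t p D))) ∧
      TwoAxis.Para.coarse (20 * ((fcellsA κ Φ t p D (gT mk gx κ Φ t p D) (fT mk fx κ Φ t p D)).K : ℤ) * (((fcellsA κ Φ t p D (gT mk gx κ Φ t p D) (fT mk fx κ Φ t p D)).s 1 : ℕ) : ℤ)) (Skelφ.NegPrm.DofA (Aof κ) (nL κ Φ t p D (gT mk gx κ Φ t p D) (fT mk fx κ Φ t p D)) (hL κ Φ t p D (gT mk gx κ Φ t p D) (fT mk fx κ Φ t p D)) (ℓL κ Φ t p D (gT mk gx κ Φ t p D) (fT mk fx κ Φ t p D)) (vL κ Φ t p D (gT mk gx κ Φ t p D) (fT mk fx κ Φ t p D)) / 2) (Skelφ.NegPrm.DofA (Aof κ) (nL κ Φ t p D (gT mk gx κ Φ t p D) (fT mk fx κ Φ t p D))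 (hL κ Φ t p D (gT mk gx κ Φ t p D) (fT mk fx κ Φ t p D)) (ℓL κ Φ t p D (gT mk gx κ Φ t p D) (fT mk fx κ Φ t p D)) (vL κ Φ t p D (gT mk gx κ Φ t p D) (fT mk fx κ Φ t p D))) (TwoAxis.Para.lam1 (Aof κ) (nL κ Φ t p D (gT mk gx κ Φ t p D) (fT mk fx κ Φ t p D) : ℤ) (hL κ Φ t p D (gT mk gx κ Φ t p D) (fT mk fx κ Φ t p D)) y) +
        ((20 * ((fcellsA κ Φ t p D (gT mk gx κ Φ t p D) (fT mk fx κ Φ t p D)).K : ℤ) * (((fcellsA κ Φ t p D (gT mk gx κ Φ t p D) (fT mk fx κ Φ t p D)).s 1 : ℕ) : ℤ)) * (Aof κ * ((shearUnit (nL κ Φ t p D (gT mk gx κ Φ t p D) (fT mk fx κ Φ t p D)) (hL κ Φ t p D (gT mk gx κ Φ t p D) (fT mk fx κ Φ t p D)) : ℤ) * (max (σ * (-pbHi κ Φ t p D (gT mk gx κ Φ t p D) (fT mk fx κ Φ t p D) mk (NrOfA κ Φ t p D (gT mk gx κ Φ t p D) (fT mk fx κ Φ t p D) σ y))) (σ *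 pbHi κ Φ t p D (gT mk gx κ Φ t p D) (fT mk fx κ Φ t p D) mk (NrOfA κ Φ t p D (gT mk gx κ Φ t p D) (fT mk fx κ Φ t p D) σ y))) + (shearUnit (nL κ Φ t p D (gT mk gx κ Φ t p D) (fT mk fx κ Φ t p D)) (hL κ Φ t p D (gT mk gx κ Φ t p D) (fT mk fx κ Φ t p D)) : ℤ) - 1))) / (Skelφ.NegPrm.DofA (Aof κ) (nL κ Φ t p D (gT mk gx κ Φ t p D) (fT mk fx κ Φ t p D)) (hL κ Φ t p D (gT mk gx κ Φ t p D) (fT mk fx κ Φ t p D)) (ℓL κ Φ t p D (gT mk gx κ Φ t p D) (fT mk fx κ Φ t p D)) (vL κ Φ t p D (gT mk gx κ Φ t p D) (fT mk fx κ Φ t p D))) + 1 ≤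
        5 * ((fcellsA κ Φ t p D (gT mk gx κ Φ t p D) (fT mk fx κ Φ t p D)).r 1 : ℤ) - 2 := by
  obtain ⟨hn1, hℓ1⟩ := one_le_of_eqNumL κ Φ t p D _ _ hN
  have hm0 := (Skelφ.NegPrm.modulus_vβOf hn1 (hL κ Φ t p D (gT mk gx κ Φ t p D) (fT mk fx κ Φ t p D)) (ℓL κ Φ t p D (gT mk gx κ Φ t p D) (fT mk fx κ Φ t p D)) (vL κ Φ t p D (gT mk gx κ Φ t p D) (fT mk fx κ Φ t p D))).1
  have hm : (nL κ Φ t p D (gT mk gx κ Φ t p D) (fT mk fx κ Φ t p D) : ℤ) * ((ℓL κ Φ t p D (gT mk gx κ Φ t p D) (fT mk fx κ Φ t p D) : ℤ) - 1) < modulus (nL κ Φ t p D (gT mk gx κ Φ t p D) (fT mk fx κ Φ t p D)) (hL κ Φ t p D (gT mk gx κ Φ t p D) (fT mk fx κ Φ t p D)) (vL κ Φ t p D (gT mk gx κ Φ t p D) (fT mk fx κ Φ t p D)) (Skelφ.NegPrm.vβOf (nL κ Φ t p D (gT mk gx κ Φ t p D) (fT mk fx κ Φ t p D)) (hL κ Φ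 t p D (gT mk gx κ Φ t p D) (fT mk fx κ Φ t p D)) (ℓL κ Φ t p D (gT mk gx κ Φ t p D) (fT mk fx κ Φ t p D)) (vL κ Φ t p D (gT mk gx κ Φ t p D) (fT mk fx κ Φ t p D))) := by linarith
  obtain ⟨hc0, hc1, hr0, hr1, hb0, hb1, hu0, hu1⟩ := units_eqA κ Φ t p D (gT mk gx κ Φ t p D) (fT mk fx κ Φ t p D)
  have hA2 : (2 : ℤ) ≤ Aof κ := by have := le_Aof κ; linarith
  have hAe : (2 : ℤ) ∣ Aof κ := ⟨10 * (Neg.K κ : ℤ), by rw [Aof_eq_K]; ring⟩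
  have hKq : (1 : ℤ) ≤ (Neg.Kq κ : ℤ) := by exact_mod_cast Neg.one_le_Kq κ
  have hv : |(vL κ Φ t p D (gT mk gx κ Φ t p D) (fT mk fx κ Φ t p D))| ≤ (nL κ Φ t p D (gT mk gx κ Φ t p D) (fT mk fx κ Φ t p D) : ℤ) := hN.v_le
  have hn : (1 : ℤ) ≤ (nL κ Φ t p D (gT mk gx κ Φ t p D) (fT mk fx κ Φ t p D) : ℤ) := by exact_mod_cast hn1
  have hsu : (nL κ Φ t p D (gT mk gx κ Φ t p D) (fT mk fx κ Φ t p D) : ℤ) ≤ (shearUnit (nL κ Φ t p D (gT mk gx κ Φ t p D) (fT mk fx κ Φ t p D)) (hL κ Φ t p D (gT mk gx κ Φ t p D) (fT mk fx κ Φ t p D)) : ℤ) ∧ (shearUnit (nL κ Φ t p D (gT mk gx κ Φ t p D) (fT mk fx κ Φ t p D)) (hL κ Φ t p D (gT mk gx κ Φ t p D) (fT mk fx κ Φ t p D)) : ℤ) ≤ 11 * (nL κ Φ t p D (gT mk gx κ Φ t p D) (fT mk fx κ Φ t p D) : ℤ) := by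
    have h10 : (((hL κ Φ t p D (gT mk gx κ Φ t p D) (fT mk fx κ Φ t p D))).natAbs : ℤ) ≤ 10 * (nL κ Φ t p D (gT mk gx κ Φ t p D) (fT mk fx κ Φ t p D) : ℤ) := by exact_mod_cast hκ
    have h0 : (0 : ℤ) ≤ (((hL κ Φ t p D (gT mk gx κ Φ t p D) (fT mk fx κ Φ t p D))).natAbs : ℤ) := by positivity
    unfold Skelφ.shearUnit
    simp only [Nat.cast_add]
    constructor <;> linarith
  obtain ⟨hW, hLb⟩ := Wrun_spec κ Φ t p D (gT mk gx κ Φ t p D) (fT mk fx κ Φ t p D) hn1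
  have hW0 : (0 : ℤ) ≤ (Wrun κ Φ t p D (gT mk gx κ Φ t p D) (fT mk fx κ Φ t p D) : ℤ) := by positivity
  have hLb0 : (0 : ℤ) ≤ (Lbrun κ Φ t p D (gT mk gx κ Φ t p D) (fT mk fx κ Φ t p D) : ℤ) := by positivity
  have hRA : (0 : ℤ) ≤ (RA' κ Φ t p D mk : ℤ) := by positivity
  have hRAn : 2000 * (Neg.Kq κ : ℤ) * ((RA' κ Φ t p D mk : ℤ) + 2) ≤ (nL κ Φ t p D (gT mk gx κ Φ t p D) (fT mk fx κ Φ t p D) : ℤ) := by exact_mod_cast hnA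
  have hRAℓ : 22000 * (Neg.Kq κ : ℤ) * ((RA' κ Φ t p D mk : ℤ) + 2) ≤ (ℓL κ Φ t p D (gT mk gx κ Φ t p D) (fT mk fx κ Φ t p D) : ℤ) := by
    have h1 : ((22000 * Neg.Kq κ * (RA' κ Φ t p D mk + 2) : ℕ) : ℤ) ≤ (ML κ Φ t p D (gT mk gx κ Φ t p D) : ℤ) := by exact_mod_cast hMA
    have h2 := hN.ℓ_le
    push_cast at h1; linarith
  have hq0 : (0 : ℤ) ≤ (qB : ℤ) := by positivity
  have hq' : 4 * (qB : ℤ) ≤ (nL κ Φ t p D (gT mk gx κ Φ t p D) (fT mk fx κ Φ t p D) : ℤ) := by exact_mod_cast hq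
  have hN0 : (0 : ℤ) ≤ ((NrOfA κ Φ t p D (gT mk gx κ Φ t p D) (fT mk fx κ Φ t p D) σ y) : ℤ) := by positivity
  obtain ⟨hN', -⟩ := NrOfA_spec κ Φ t p D (gT mk gx κ Φ t p D) (fT mk fx κ Φ t p D) hN hσ y hΛ
  have hN1 : ((NrOfA κ Φ t p D (gT mk gx κ Φ t p D) (fT mk fx κ Φ t p D) σ y) : ℤ) + 1 ≤ 1000 * (Neg.Kq κ : ℤ) := by
    have : ((0 + 1 + NrOfA κ Φ t p D (gT mk gx κ Φ t p D) (fT mk fx κ Φ t p D) σ y : ℕ) : ℤ) ≤ ((1000 * Neg.Kq κ : ℕ) : ℤ) := by exact_mod_cast hN'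
    push_cast at this; linarith
  unfold pbHi TwoAxis.Para.coarse
  rw [hc1, DofA_eq', (lam_eqA κ Φ t p D (gT mk gx κ Φ t p D) (fT mk fx κ Φ t p D) y).2]
  have e3 : -(5 * ((fcellsA κ Φ t p D (gT mk gx κ Φ t p D) (fT mk fx κ Φ t p D)).r 1 : ℤ) - 2) = -(5 * (40 * (Neg.Kq κ : ℤ) * u₁A κ Φ t p D (gT mk gx κ Φ t p D) (fT mk fx κ Φ t p D)) - 2) := by rw [hr1]
  have e4 : 5 * ((fcellsA κ Φ t p D (gT mk gx κ Φ t p D) (fT mk fx κ Φ t p D)).r 1 : ℤ) - 2 = 5 * (40 * (Neg.Kq κ : ℤ) * u₁A κ Φ t p D (gT mk gx κ Φ t p D) (fT mk fx κ Φ t p D)) - 2 := by rw [hr1]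
  rw [e3, e4]
  exact RootArithA.trans_prismA (A := Aof κ) (Q := (Neg.Kq κ : ℤ)) (u := u₁A κ Φ t p D (gT mk gx κ Φ t p D) (fT mk fx κ Φ t p D)) (Λ := Λ₁of κ Φ t p D (gT mk gx κ Φ t p D) (fT mk fx κ Φ t p D) y) (v := (vL κ Φ t p D (gT mk gx κ Φ t p D) (fT mk fx κ Φ t p D))) hA2 hAe hKq hu1 hn hm hsu.1 hsu.2 hv hW hW0 hLb hLb0 hRA hRAℓ hN0 hN1 hσ hΛ₁

end AtT

end KS

end NegB

end PlanarSkeletonNeg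

end Summit.CriticalPhenomena.PercolationContinuityZ3.Theorems.Transplant
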